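import Literature.Computability.Complexity.StackBluestein
import Literature.Computability.Complexity.StackNumericGcd
import HarnessLib

/-!
# Harvey's Algorithm 1 (collisions) on the stack machine

Literature / complexity toolkit, continuing `StackBluestein.lean` (leaves pass, Bluestein's
evaluation), `StackProductTree.lean` (the product tree) and `StackNumericGcd.lean` (the gcd).
Harvey's Algorithm 1 (arXiv:2010.05450, §4, Prop. 14): given values `v_1 … v_{2^e}` (on `A1V`),
a base `α`, a shift `c` and a count `m`, compute `F = ∏ (x − v_h)` by the product tree, scale the
coefficients by `c^j` (so that the points are `c α^i` — the inverse-free variant used by the search),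
evaluate at `α^i`, `i < m`, by Bluestein, and scan the gcds `γ_i = gcd(N, w_i)`; at the first `i`
with `γ_i ≠ 1` stop: `γ_i ∉ {1, N}` is a factor, and `γ_i = N` triggers the scan over `h` of
`gcd(N, c α^i − v_h)` (done by the same value scan on the residues).  Control is by flag-guarded
fixed-count loops (`whenNot`, `whenTrue` over `Com.pop`), the casework by `NS.ite`.

* `runs_a1Tree`, `runs_a1Coef` (`a1Coefs`), `firstHit` / `firstHit_spec` / `gcdHit`, `a1Case1`,
  `runs_a1Scan1` (`HSlots.srch1`, `HSlots.fnd1`, `HSlots.scan1Res`), `runs_a1Resid` (`a1Resids`),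
  `runs_a1Scan2_true` / `runs_a1Scan2_nil`, and **`runs_alg1`**: the registers at the end are
  `u.alg1Final (alg1Out N α c m k e b vs)` — `alg1Out = (factor?, hit i?, exact h?)` — within
  `alg1Cost n e k m` steps;
* the meaning of the outcome (§"What the outcome of Algorithm 1 means"): `alg1_value_eq`
  (`w_i = α^E ∏ₕ (c α^i − v_h)` in `ℤ/N`), `alg1Out_factor` (a proper divisor of `N`),
  `alg1Out_exact` (`v_h ≡ c α^i (mod N)`), `alg1Out_clear` (nothing found ⇒ no `v_h ≡ c α^i`
  modulo any prime factor of `N`), `alg1Out_hit_resolved` (a hit at `i` is always resolved by the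
  second scan when `α` is a unit) — Harvey's Prop. 14 correctness argument.

## References

* D. Harvey, *An exponent one-fifth algorithm for deterministic integer factorisation*,
  Math. Comp. 90 (2021) 2937–2950, §4, Algorithm 1 and Prop. 4.1 / arXiv:2010.05450 Prop. 14.
  [Harvey2021]
* M. Hittmeir, *A time-space tradeoff for Lehman's deterministic integer factorization method*,
  Math. Comp. 90 (2021), Algorithm 3.2. (Folklore material, fully proved here.)
-/

namespace Literature.Computability.Complexity

open _root_.Computability SProg

namespace Com

variable {β : Type} [DecidableEq β] (h : HReg ↪ β)

/-! ### Algorithm 1 (collisions) on the machine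

Harvey's Algorithm 1 (arXiv:2010.05450, §4): from the values `v_1 … v_{2^e}` (on `A1V`), the base
`α`, the shift `c`, the count `m`: the product tree of `∏ (x − v_h)`, the coefficients scaled by
`c^j` (so that the values at `α^i` are those of `f` at `c α^i`), Bluestein's evaluation, the gcd
scan over `i`, and — at the first `i` whose gcd is `N` — the scan over `h`. -/

section AlgOne

/-- Run `body` unless the flag register `F` holds a bit (the flag is kept). [folklore] -/
def whenNot (F : HReg) (body : Com (EReg ⊕ β)) : Com (EReg ⊕ β) :=
  Com.pop (Sum.inr (h F)) (Com.push (Sum.inr (h F)) true) (Com.push (Sum.inr (h F)) false) body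

/-- Run `body` when the flag register `F` holds `true` (the flag is kept). [folklore] -/
def whenTrue (F : HReg) (body : Com (EReg ⊕ β)) : Com (EReg ⊕ β) :=
  Com.pop (Sum.inr (h F)) (Com.push (Sum.inr (h F)) true ;; body) (Com.push (Sum.inr (h F)) false) skip

/-- `runs_whenNot_nil`. [folklore] -/
theorem runs_whenNot_nil {F : HReg} {body : Com (EReg ⊕ β)} (T'' : Regs β) (hF : T'' (h F) = []) {R' : Regs (EReg ⊕ β)} {B : ℕ}
    (hb : Runs body (base T'') R' B) : Runs (whenNot h F body) (base T'') R' (B + 2) :=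
  Runs.opop_nil _ _ hF hb

/-- `runs_whenNot_true`. [folklore] -/
theorem runs_whenNot_true {F : HReg} (body : Com (EReg ⊕ β)) (T'' : Regs β) (hF : T'' (h F) = [true]) :
    Runs (whenNot h F body) (base T'') (base T'') (1 + 2) := by
  refine Runs.opop_true _ _ hF ((Runs.push _ _ _).of_eq ?_ le_rfl)
  simp only [update_nst_inr]; congr 1
  funext r; by_cases hr : r = h F
  · subst hr; simp [hF]
  · simp [hr]

/-- `runs_whenTrue_nil`. [folklore] -/
theorem runs_whenTrue_nil {F : HReg} (body : Com (EReg ⊕ β)) (T'' : Regs β) (hF : T'' (h F) = []) :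
    Runs (whenTrue h F body) (base T'') (base T'') (0 + 2) :=
  Runs.opop_nil _ _ hF (Runs.skip _)

/-- `runs_whenTrue_true`. [folklore] -/
theorem runs_whenTrue_true {F : HReg} {body : Com (EReg ⊕ β)} (T'' : Regs β) (hF : T'' (h F) = [true]) {R' : Regs (EReg ⊕ β)} {B : ℕ}
    (hb : Runs body (base T'') R' B) : Runs (whenTrue h F body) (base T'') R' (1 + B + 2) := by
  refine Runs.opop_true _ _ hF (((Runs.push _ _ _).of_eq ?_ le_rfl).seq hb)
  simp only [update_nst_inr]; congr 1
  funext r; by_cases hr : r = h F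
  · subst hr; simp [hF]
  · simp [hr]

/-- Preparation: a copy of the values on `L1`, the tree parameters (`X1 = 2^{e-1}` as the tail of
`2^e`, `PTK = 2`, `PTU = 1^e`). [folklore] -/
def a1Prep : Com (EReg ⊕ β) :=
  copy (Sum.inr (h .A1V)) (Sum.inr (h .L1)) (ra .t) (ra .u) ;;
  (pow2Into (rGH h) (h .X1) (h .A1P) ;;
  (((NS.ofList [.drop (h .X1), .const (h .PTK) (encodeNat 2)] : NS β).com) ;;
  nToUnary (h .PTU) (h .A1P)))

/-- Preparation, leaves, product tree. [folklore] -/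
def a1Tree : Com (EReg ⊕ β) :=
  a1Prep h ;; (leafPass h ;; ptTree h)

/-- Cost of `a1Tree`. [folklore] -/
def a1TreeCost (n e : ℕ) : ℕ :=
  (10 * (2 ^ e * (2 * n)) + 3) + (n * (16 * e + 21) + 3 * e + 7) + 6 * (n + 1) ^ 3 + ((e + 1) * (16 * 2 ^ e + 21) + 5) +
    leafPassCost n (2 ^ e) + (e * (ptLevelBound n e + 2) + 1)

/-- **Preparation, leaves and product tree.** [folklore] -/
theorem runs_a1Tree {N e n : ℕ} (hNodd : Odd N) (hN1 : 1 < N) (hn : (encodeNat N).length + 1 ≤ n) (hen : e + 6 ≤ n)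
    (T : Regs β) (hI : DrvInv (rGH h) N T) (hCI : T (h (.g .CINV)) = encodeNat (NegFFT.inv2N N))
    (u : HSlots) (hw : u.gw.Clean) (hsched : u.gw.sched = []) (hhist : u.gw.hist = []) (hbg : u.gw.bg = []) (hkn' : u.gw.kn = []) (hbf : u.gw.bf = [])
    {vs : List ℕ} (hvs : vs.length = 2 ^ e) (hvN : ∀ v ∈ vs, v < N) (ha1v : u.a1v = encVec vs) (ha1p : u.a1p = encodeNat e)
    (hl1 : u.l1 = []) (hx1 : u.x1 = []) (hx2 : u.x2 = []) (hx3 : u.x3 = []) (hx4 : u.x4 = []) (hx5 : u.x5 = []) (hx6 : u.x6 = [])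
    (hfl1 : u.fl1 = []) (hl4 : u.l4 = []) (hptk : u.ptk = []) (hptu : u.ptu = []) :
    Runs (a1Tree h) (base (hSt h T u))
      (base (hSt h T { u with a1v := [], l1 := encVec vs, ptk := encodeNat (2 + e), gw := { u.gw with bf := encBlocks (NegFFT.prodTreeH N e vs) } }))
      (a1TreeCost n e) := by
  have hhq : ∀ {i j : HReg}, i ≠ j → h i ≠ h j := fun hij => hq_ne h hij
  obtain ⟨-, -, -, -, -, -, -, -, -, -, hU, -, -, -, -, -, -, -⟩ := id hI
  obtain ⟨-, -, -, -, -, -, -, -, -, -, -, -, -, htmph, -, -, -, -, -, -⟩ := id hw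
  have hN0 : 0 < N := by omega
  set c := (n + 1) ^ 3 with hc3
  have rdU : ∀ u' : HSlots, hSt h T u' (h (.g (.f (.n (.v .U))))) = [] := fun u' => by
    rw [hSt_gv h T u' (by decide) (by decide) (by decide) (by decide) (by decide) (by decide)]; exact hU
  have hle : (encodeNat e).length ≤ n := (length_encodeNat_le_succ (le_two_pow_self e)).trans (by omega)
  have hlV : (encVec vs).length ≤ 2 ^ e * (2 * n) := by
    have := length_encVec_le_of_lt hvN hn; rwa [hvs] at this
  have e2 : encodeNat 2 = [false, true] := by simpa using encodeNat_two_pow 1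
  -- copy
  let u1 : HSlots := { u with l1 := encVec vs }
  have h1 : Runs (copy (Sum.inr (h .A1V)) (Sum.inr (h .L1)) (ra .t) (ra .u)) (base (hSt h T u)) (base (hSt h T u1)) (10 * (2 ^ e * (2 * n)) + 3) := by
    refine (runs_ocopy (a := h .A1V) (b := h .L1) (hhq (by decide)) (hSt h T u)).of_eq ?_ ?_
    · simp [u1, ha1v, hl1]
    · simp only [hSt_A1V, ha1v]; omega
  let u2 : HSlots := { u1 with x1 := encodeNat (2 ^ e) }
  have h2 : Runs (pow2Into (rGH h) (h .X1) (h .A1P)) (base (hSt h T u1)) (base (hSt h T u2)) (n * (16 * e + 21) + 3 * e + 7) := by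
    have hne : h .X1 ≠ h .A1P := hhq (by decide)
    have hneU : h .X1 ≠ (rGH h) (.f (.n (.v .U))) := (rGH_ne h .X1 (fun _ e => HReg.noConfusion e) _).symm
    have r1 : hSt h T u1 (h .A1P) = encodeNat e := by rw [hSt_A1P]; exact ha1p
    have r2 : hSt h T u1 (h .X1) = [] := by rw [hSt_X1]; exact hx1
    refine (runs_pow2Into (rGH h) hneU hne hle (hSt h T u1) r1 r2 (rdU u1)).of_eq ?_ le_rfl
    rw [update_hSt_X1]
  let u3 : HSlots := { u2 with x1 := (encodeNat (2 ^ e)).tail, ptk := encodeNat 2 }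
  have h3 : Runs ((NS.ofList [.drop (h .X1), .const (h .PTK) (encodeNat 2)] : NS β).com) (base (hSt h T u2)) (base (hSt h T u3)) (6 * c) := by
    refine NS.runs_of_eq (N := n) _ _ ?_ ?_ (by simp [hc3])
    · simp only [NS.ofList, NS.ok, NOp.ok, NS.eval, NOp.eval, hSt_X1, update_hSt_X1, hSt_PTK, u2, u1, hptk, List.length_nil, e2, List.length_cons,
        true_and, and_true]
      refine ⟨?_, ?_⟩ <;> omega
    · simp [u2, u3, u1]
  let u4 : HSlots := { u3 with ptu := List.replicate e true }
  have h4 : Runs (nToUnary (h .PTU) (h .A1P)) (base (hSt h T u3)) (base (hSt h T u4)) ((e + 1) * (16 * 2 ^ e + 21) + 5) := by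
    refine (runs_nToUnary (h .PTU) (h .A1P) (hSt h T u3) (by simp [u3, u2, u1, hptu])).of_eq ?_ ?_
    · simp [u3, u4, u2, u1, ha1p]
    · simp only [hSt_A1P, u3, u2, u1, ha1p, bitsToNat_encodeNat]
      exact toUnary_cost_le (le_two_pow_self e)
  -- leaves
  have hvn : ∀ v ∈ vs, (encodeNat v).length ≤ n := fun v hv => (Brick.length_encodeNat_mono (hvN v hv).le).trans (by omega)
  have h5 := runs_leafPass h hN1 hn T hI { u4 with a1v := [], l4 := [] } (by simp [u4, u3, u2, u1, htmph]) (by simp [u4, u3, u2, u1, hbf]) hvn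
    (by simp [u4, u3, u2, u1, hx3]) (by simp [u4, u3, u2, u1, hx4]) (by simp [u4, u3, u2, u1, hx5]) (by simp [u4, u3, u2, u1, hx6]) (by simp [u4, u3, u2, u1, hfl1])
  have h45 : hSt h T { ({ u4 with a1v := [], l4 := [] } : HSlots) with a1v := encVec vs, l4 := [] } = hSt h T u4 := by
    simp [u4, u3, u2, u1, ha1v, hl4]
  rw [h45] at h5
  -- tree
  have h6 := runs_ptTree h hNodd hN1 hn hen T hI hCI
    { u4 with a1v := [], l4 := [], gw := { u4.gw with bf := encBlocks (vs.map (NegFFT.linBlock (N := N))) } }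
    (by simpa [u4, u3, u2, u1] using hw.with_bf _) (by simp [u4, u3, u2, u1, hsched]) (by simp [u4, u3, u2, u1, hhist]) (by simp [u4, u3, u2, u1, hbg])
    (by simp [u4, u3, u2, u1, hkn']) hvs (by simp) (by simp [u4, u3]) (by simp [u4, u3]) (by simp [u4, u3, u2, u1, hx2]) (by simp [u4])
  refine ((h1.seq (h2.seq (h3.seq h4))).seq (h5.seq h6)).of_eq ?_ ?_
  · simp [u4, u3, u2, u1, hl4, hptu, hx1]
  · simp only [a1TreeCost, ← hc3, hvs]; omega

/-! #### The scaled coefficient list -/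

/-- The machine's coefficient list: `g_j = (c^j mod N) · b_j mod N`, `j < d`. [folklore] -/
def a1Coefs (N c : ℕ) (b : List ℕ) (d : ℕ) : List ℕ := (List.range d).map fun j => c ^ j % N * b.getD j 0 % N

/-- `a1Coefs_succ`. [folklore] -/
theorem a1Coefs_succ (N c : ℕ) (b : List ℕ) (d : ℕ) : a1Coefs N c b (d + 1) = a1Coefs N c b d ++ [c ^ d % N * b.getD d 0 % N] := by
  simp [a1Coefs, List.range_succ]

/-- One coefficient: read `b_j`, `c^j`, multiply, count, emit. [folklore] -/
def a1CoefBody : Com (EReg ⊕ β) :=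
  readItemTo (Sum.inr (h .X3)) (Sum.inr (h .X4)) (Sum.inr (h (.g (.f (.n (.v .W)))))) (Sum.inr (h (.g (.f (.n (.v .TT)))))) ;;
  (((NS.ofList [.powMod (h .X5) (h .A1C) (h .BLC2) (h (.g (.f (.n (.v .MD))))), .mulMod (h .X5) (h .X4) (h (.g (.f (.n (.v .MD))))),
      .clear (h .X4), .succ (h .X4) (h .BLC2), .clear (h .BLC2), .move (h .X4) (h .BLC2)] : NS β).com) ;;
  emit (Sum.inr (h .X5)) (Sum.inr (h .L4)))

/-- The coefficient pass: read the tree's block off `BF`, emit `2^e + 1` scaled coefficients onto `BLF`. [folklore] -/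
def a1Coef : Com (EReg ⊕ β) :=
  readItemTo (Sum.inr (h (.g .BF))) (Sum.inr (h .X3)) (Sum.inr (h (.g (.f (.n (.v .W)))))) (Sum.inr (h (.g (.f (.n (.v .TT)))))) ;;
  (pow2Into (rGH h) (h .X4) (h .A1P) ;;
  (((NS.ofList [.succ (h .X5) (h .X4), .clear (h .X4)] : NS β).com) ;;
  (nToUnary (h .U1) (h .X5) ;;
  (((NS.op (.clear (h .X5))) : NS β).com ;;
  (countLoop (Sum.inr (h .U1)) (a1CoefBody h) ;;
  (pour (Sum.inr (h .L4)) (Sum.inr (h .BLF)) ;;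
  (clear (Sum.inr (h .X3)) ;;
  ((NS.ofList [.clear (h .BLC2), .clear (h .PTK)] : NS β).com))))))))

/-- Cost of the coefficient pass. [folklore] -/
def a1CoefCost (n e : ℕ) : ℕ :=
  (11 * (2 ^ (e + 2) * (2 * n)) + 9) + (n * (16 * e + 21) + 3 * e + 7) + 84 * (n + 1) ^ 3 + ((e + 2) * (16 * 2 ^ (e + 1) + 21) + 5) +
    ((2 ^ e + 1) * (3000 * (n + 1) ^ 3 + 2) + 1) + 5 * (2 ^ (e + 2) * (2 * n)) + 2

/-- **The coefficient pass.** [folklore] -/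
theorem runs_a1Coef {N n e c : ℕ} (hN1 : 1 < N) (hn : (encodeNat N).length + 1 ≤ n) (hen : e + 6 ≤ n) (T : Regs β) (hI : DrvInv (rGH h) N T)
    (u : HSlots) {b : List ℕ} (hb : NegFFT.BlockOK N (2 ^ (e + 2)) b) (hbf : u.gw.bf = encBlocks [b]) (hcN : c < N)
    (ha1c : u.a1c = encodeNat c) (ha1p : u.a1p = encodeNat e) (hptk : u.ptk = encodeNat (2 + e)) (hblc2 : u.blc2 = []) (hblf : u.blf = [])
    (hx3 : u.x3 = []) (hx4 : u.x4 = []) (hx5 : u.x5 = []) (hu1 : u.u1 = []) (hl4 : u.l4 = []) :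
    Runs (a1Coef h) (base (hSt h T u))
      (base (hSt h T { u with ptk := [], blf := encVec (a1Coefs N c b (2 ^ e + 1)), gw := { u.gw with bf := [] } })) (a1CoefCost n e) := by
  have hhq : ∀ {i j : HReg}, i ≠ j → h i ≠ h j := fun hij => hq_ne h hij
  obtain ⟨hMD, -, -, -, -, -, hW, hTT, -, -, hU, -, -, -, -, -, -, -⟩ := hI
  have hN0 : 0 < N := by omega
  set c3 := (n + 1) ^ 3 with hc3
  have hc1 : n + 1 ≤ c3 := by
    rw [hc3]; calc n + 1 = (n + 1) ^ 1 := (pow_one _).symm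
      _ ≤ (n + 1) ^ 3 := Nat.pow_le_pow_right (by omega) (by omega)
  have rdMD : ∀ u' : HSlots, hSt h T u' (h (.g (.f (.n (.v .MD))))) = encodeNat N := fun u' => by
    rw [hSt_gv h T u' (by decide) (by decide) (by decide) (by decide) (by decide) (by decide)]; exact hMD
  have rdW : ∀ u' : HSlots, hSt h T u' (h (.g (.f (.n (.v .W))))) = [] := fun u' => by
    rw [hSt_gv h T u' (by decide) (by decide) (by decide) (by decide) (by decide) (by decide)]; exact hW
  have rdTT : ∀ u' : HSlots, hSt h T u' (h (.g (.f (.n (.v .TT))))) = [] := fun u' => by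
    rw [hSt_gv h T u' (by decide) (by decide) (by decide) (by decide) (by decide) (by decide)]; exact hTT
  have rdU : ∀ u' : HSlots, hSt h T u' (h (.g (.f (.n (.v .U))))) = [] := fun u' => by
    rw [hSt_gv h T u' (by decide) (by decide) (by decide) (by decide) (by decide) (by decide)]; exact hU
  have hlN : (encodeNat N).length ≤ n := by omega
  have hlc : (encodeNat c).length ≤ n := (Brick.length_encodeNat_mono hcN.le).trans hlN
  have hle : (encodeNat e).length ≤ n := (length_encodeNat_le_succ (le_two_pow_self e)).trans (by omega)
  have h2e4 : 2 ^ e * 4 = 2 ^ (e + 2) := by rw [pow_add]; norm_num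
  have h2e1 : 2 ^ e + 1 ≤ 2 ^ (e + 1) := by rw [pow_succ]; have := Nat.one_le_two_pow (n := e); omega
  have hlsmall : ∀ x, x ≤ 2 ^ (e + 2) → (encodeNat x).length ≤ n := fun x hx =>
    (Brick.length_encodeNat_mono hx).trans (by rw [encodeNat_two_pow]; simp; omega)
  have hlb : (encVec b).length ≤ 2 ^ (e + 2) * (2 * n) := by
    have := length_encVec_le_of_lt hb.2 hn; rwa [hb.1] at this
  -- read the block
  let u1 : HSlots := { u with x3 := encVec b, gw := { u.gw with bf := [] } }
  have h1 : Runs (readItemTo (Sum.inr (h (.g .BF))) (Sum.inr (h .X3)) (Sum.inr (h (.g (.f (.n (.v .W)))))) (Sum.inr (h (.g (.f (.n (.v .TT)))))))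
      (base (hSt h T u)) (base (hSt h T u1)) (11 * (2 ^ (e + 2) * (2 * n)) + 9) := by
    refine (runs_readItemTo (by simp [hhq]) (by simp [hhq]) (by simp [hhq]) (by simp [hhq]) (by simp [hhq]) (encVec b) []
      (base (hSt h T u)) (by simp [hbf, encBlocks, encList, boolPair, dbl]) (by simp [rdW]) (by simp [rdTT])).of_eq ?_ (by omega)
    simp [u1, hx3]
  let u2 : HSlots := { u1 with x4 := encodeNat (2 ^ e) }
  have h2 : Runs (pow2Into (rGH h) (h .X4) (h .A1P)) (base (hSt h T u1)) (base (hSt h T u2)) (n * (16 * e + 21) + 3 * e + 7) := by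
    have hne : h .X4 ≠ h .A1P := hhq (by decide)
    have hneU : h .X4 ≠ (rGH h) (.f (.n (.v .U))) := (rGH_ne h .X4 (fun _ e => HReg.noConfusion e) _).symm
    have r1 : hSt h T u1 (h .A1P) = encodeNat e := by rw [hSt_A1P]; exact ha1p
    have r2 : hSt h T u1 (h .X4) = [] := by rw [hSt_X4]; exact hx4
    refine (runs_pow2Into (rGH h) hneU hne hle (hSt h T u1) r1 r2 (rdU u1)).of_eq ?_ le_rfl
    rw [update_hSt_X4]
  let u3 : HSlots := { u1 with x5 := encodeNat (2 ^ e + 1) }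
  have h3 : Runs ((NS.ofList [.succ (h .X5) (h .X4), .clear (h .X4)] : NS β).com) (base (hSt h T u2)) (base (hSt h T u3)) (75 * c3) := by
    refine NS.runs_of_eq (N := n) _ _ ?_ ?_ (by simp [hc3])
    · simp only [NS.ofList, NS.ok, NOp.ok, NS.eval, NOp.eval, hSt_X4, hSt_X5, update_hSt_X5, u2, u1, hx5, List.length_nil, zero_le, and_true]
      exact ⟨hlsmall _ (by rw [pow_add]; omega), hlsmall _ (by rw [pow_add]; omega)⟩
    · simp [u2, u3, u1, hx4, hx5]
  let cst : ℕ → HSlots := fun i =>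
    { u1 with u1 := List.replicate i true, x3 := encVec (b.drop (2 ^ e + 1 - i)), blc2 := encodeNat (2 ^ e + 1 - i), l4 := outRev ((a1Coefs N c b (2 ^ e + 1 - i)).map encodeNat) }
  have h4 : Runs (nToUnary (h .U1) (h .X5)) (base (hSt h T u3)) (base (hSt h T { u3 with u1 := List.replicate (2 ^ e + 1) true })) ((e + 2) * (16 * 2 ^ (e + 1) + 21) + 5) := by
    refine (runs_nToUnary (h .U1) (h .X5) (hSt h T u3) (by simp [u3, u1, hu1])).of_eq ?_ ?_
    · simp [u3]
    · simp only [hSt_X5, u3, bitsToNat_encodeNat]; exact toUnary_cost_le h2e1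
  have h5 : Runs (NS.op (.clear (h .X5)) : NS β).com (base (hSt h T { u3 with u1 := List.replicate (2 ^ e + 1) true })) (base (hSt h T (cst (2 ^ e + 1)))) (3 * c3) := by
    refine NS.runs_of_eq (N := n) _ _ (by simp only [NS.ok, NOp.ok, hSt_X5, u3]; exact hlsmall _ (by rw [pow_add]; omega)) ?_ (by simp [hc3])
    simp [u3, u1, cst, hx5, hblc2, hl4, a1Coefs, show encodeNat 0 = [] from rfl]
  have hbody : ∀ i, i + 1 ≤ 2 ^ e + 1 → Runs (a1CoefBody h) (base (hSt h T { cst (i + 1) with u1 := List.replicate i true })) (base (hSt h T (cst i))) (3000 * c3) := by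
    intro i hi
    set d := 2 ^ e + 1 - (i + 1) with hd0
    have hd1 : 2 ^ e + 1 - i = d + 1 := by omega
    have hlt : d < b.length := by rw [hb.1, ← h2e4]; omega
    obtain ⟨a, l, hal⟩ : ∃ a l, b.drop d = a :: l := by
      cases hd : b.drop d with
      | nil => exact absurd (List.drop_eq_nil_iff.1 hd) (by omega)
      | cons a l => exact ⟨a, l, rfl⟩
    obtain ⟨hdrop', hgetD⟩ := drop_eq_cons_facts b _ a l hal
    have ha : a < N := hb.2 a (List.mem_of_mem_drop (l := b) (i := d) (by rw [hal]; simp))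
    have hla : (encodeNat a).length ≤ n := (Brick.length_encodeNat_mono ha.le).trans hlN
    have hld : (encodeNat d).length ≤ n := hlsmall _ (by rw [← h2e4]; omega)
    have hld1 : (encodeNat (d + 1)).length ≤ n := hlsmall _ (by rw [← h2e4]; omega)
    have hl7 : (encodeNat (c ^ d % N)).length ≤ n := (Brick.length_encodeNat_mono (Nat.mod_lt _ hN0).le).trans hlN
    have hl8 : (encodeNat (c ^ d % N * a % N)).length ≤ n := (Brick.length_encodeNat_mono (Nat.mod_lt _ hN0).le).trans hlN
    let ua : HSlots := { cst (i + 1) with u1 := List.replicate i true }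
    let ub : HSlots := { ua with x3 := encVec l, x4 := encodeNat a }
    let uc : HSlots := { ub with x4 := [], blc2 := encodeNat (d + 1), x5 := encodeNat (c ^ d % N * a % N) }
    have g1 : Runs (readItemTo (Sum.inr (h .X3)) (Sum.inr (h .X4)) (Sum.inr (h (.g (.f (.n (.v .W)))))) (Sum.inr (h (.g (.f (.n (.v .TT)))))))
        (base (hSt h T ua)) (base (hSt h T ub)) (11 * n + 9) := by
      refine (runs_readItemTo (by simp [hhq]) (by simp [hhq]) (by simp [hhq]) (by simp [hhq]) (by simp [hhq]) (encodeNat a) (encVec l)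
        (base (hSt h T ua)) (by simp [ua, cst, ← hd0, hal, encVec_cons]) (by simp [rdW]) (by simp [rdTT])).of_eq ?_ (by omega)
      simp [ua, ub, cst, u1, hx4]
    have g2 : Runs ((NS.ofList [.powMod (h .X5) (h .A1C) (h .BLC2) (h (.g (.f (.n (.v .MD))))), .mulMod (h .X5) (h .X4) (h (.g (.f (.n (.v .MD))))),
        .clear (h .X4), .succ (h .X4) (h .BLC2), .clear (h .BLC2), .move (h .X4) (h .BLC2)] : NS β).com) (base (hSt h T ub)) (base (hSt h T uc)) (2926 * c3) := by
      refine NS.runs_of_eq (N := n) _ _ ?_ ?_ (by simp [hc3])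
      · simp (config := { decide := true }) only [NS.ofList, NS.ok, NOp.ok, NS.eval, NOp.eval, hSt_X4, hSt_X5, hSt_BLC2, hSt_A1C,
          update_hSt_X4, update_hSt_X5, update_hSt_BLC2, ub, ua, cst, u1, ← hd0, hx5, ha1c, rdMD, bitsToNat_encodeNat, ne_eq,
          EmbeddingLike.apply_eq_iff_eq, List.length_nil, zero_le, and_self, hld, hld1, hl7, hla, hlc, hlN, hN1, hN0, not_false_eq_true]
      · simp [ub, uc, ua, cst, u1, ← hd0, hx5, ha1c, rdMD]
    have g3 : Runs (emit (Sum.inr (h .X5)) (Sum.inr (h .L4))) (base (hSt h T uc)) (base (hSt h T (cst i))) (4 * n + 3) := by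
      refine (runs_emit (h := (Sum.inr (h .X5) : EReg ⊕ β)) (o := Sum.inr (h .L4)) (by simp [hhq]) (base (hSt h T uc))).of_eq ?_ ?_
      · have hgetD' : b[d]?.getD 0 = a := by rw [← List.getD_eq_getElem?_getD]; exact hgetD
        simp [uc, ub, ua, cst, u1, ← hd0, hd1, hx4, hx5, a1Coefs_succ, hgetD', hdrop', List.map_append, outRev_append]
      · simp only [nst_inr, hSt_X5, uc]; omega
    exact (g1.seq (g2.seq g3)).of_eq rfl (by omega)
  have hL := runs_countLoop (U := (Sum.inr (h .U1) : EReg ⊕ β)) (body := a1CoefBody h) (fun i R => i ≤ 2 ^ e + 1 ∧ R = base (hSt h T (cst i))) (3000 * c3)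
    (by
      rintro i R ⟨hi, rfl⟩ -
      have : Function.update (base (hSt h T (cst (i + 1)))) (Sum.inr (h .U1)) (List.replicate i true) = base (hSt h T { cst (i + 1) with u1 := List.replicate i true }) := by
        simp [cst]
      rw [this]
      exact ⟨_, hbody i hi, by simp [cst], by omega, rfl⟩)
    (2 ^ e + 1) (base (hSt h T (cst (2 ^ e + 1)))) ⟨le_rfl, rfl⟩ (by simp [cst])
  obtain ⟨R', hR, -, -, rfl⟩ := hL
  -- pour, clear, clears
  set G := a1Coefs N c b (2 ^ e + 1) with hG0
  have hGN : ∀ x ∈ G, x < N := fun x hx => by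
    simp only [hG0, a1Coefs, List.mem_map, List.mem_range] at hx
    obtain ⟨j, -, rfl⟩ := hx; exact Nat.mod_lt _ hN0
  have hGl : G.length = 2 ^ e + 1 := by simp [hG0, a1Coefs]
  have hlG : (encVec G).length ≤ 2 ^ (e + 2) * (2 * n) := by
    have := length_encVec_le_of_lt hGN hn; rw [hGl] at this; exact this.trans (Nat.mul_le_mul_right _ (by rw [← h2e4]; omega))
  have hrev : (outRev (G.map encodeNat)).reverse = encVec G := by rw [reverse_outRev]; rfl
  have hlo : (outRev (G.map encodeNat)).length = (encVec G).length := by rw [← hrev, List.length_reverse]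
  have hrestN : ∀ x ∈ b.drop (2 ^ e + 1), x < N := fun x hx => hb.2 x (List.mem_of_mem_drop hx)
  have hlrest : (encVec (b.drop (2 ^ e + 1))).length ≤ 2 ^ (e + 2) * (2 * n) :=
    (length_encVec_le_of_lt hrestN hn).trans (Nat.mul_le_mul_right _ (by rw [List.length_drop, hb.1]; omega))
  let w1 : HSlots := { cst 0 with l4 := [], blf := encVec G }
  let w2 : HSlots := { w1 with x3 := [] }
  have p1 : Runs (pour (Sum.inr (h .L4)) (Sum.inr (h .BLF))) (base (hSt h T (cst 0))) (base (hSt h T w1)) (3 * (2 ^ (e + 2) * (2 * n)) + 1) := by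
    refine (runs_opour (a := h .L4) (b := h .BLF) (hhq (by decide)) (hSt h T (cst 0))).of_eq ?_ ?_
    · simp [cst, w1, u1, hrev, hblf, ← hG0]
    · simp only [hSt_L4, cst, Nat.sub_zero, ← hG0, hlo]; omega
  have p2 : Runs (clear (Sum.inr (h .X3))) (base (hSt h T w1)) (base (hSt h T w2)) (2 * (2 ^ (e + 2) * (2 * n)) + 1) := by
    refine (runs_clear (Sum.inr (h .X3)) (base (hSt h T w1))).of_eq (by simp [w1, w2]) ?_
    simp only [nst_inr, hSt_X3, w1, cst, Nat.sub_zero]; omega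
  have p3 : Runs ((NS.ofList [.clear (h .BLC2), .clear (h .PTK)] : NS β).com) (base (hSt h T w2))
      (base (hSt h T { u with ptk := [], blf := encVec G, gw := { u.gw with bf := [] } })) (6 * c3) := by
    refine NS.runs_of_eq (N := n) _ _ ?_ ?_ (by simp [hc3])
    · simp only [NS.ofList, NS.ok, NOp.ok, NS.eval, NOp.eval, hSt_BLC2, hSt_PTK, update_hSt_BLC2, w2, w1, cst, u1, hptk, Nat.sub_zero, and_true]
      exact ⟨hlsmall _ (by rw [← h2e4]; omega), (Brick.length_encodeNat_mono (show 2 + e ≤ 2 ^ (e + 2) by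
        have := le_two_pow_self e; rw [pow_add]; omega)).trans (by rw [encodeNat_two_pow]; simp; omega)⟩
    · simp [w2, w1, cst, u1, hu1, hblc2, hl4, hx3]
  refine (h1.seq (h2.seq (h3.seq (h4.seq (h5.seq (hR.seq (p1.seq (p2.seq p3)))))))).of_eq rfl ?_
  simp only [a1CoefCost, ← hc3]
  omega

/-! #### The gcd scan over the values -/

/-- The first index below `j` where `p` holds. [folklore] -/
def firstHit (p : ℕ → Bool) : ℕ → Option ℕ
  | 0 => none
  | j + 1 => match firstHit p j with
    | some i => some i
    | none => if p j then some j else none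

/-- `firstHit_succ_of_some`. [folklore] -/
theorem firstHit_succ_of_some {p : ℕ → Bool} {j i : ℕ} (hj : firstHit p j = some i) : firstHit p (j + 1) = some i := by
  simp [firstHit, hj]

/-- `firstHit_succ_of_none`. [folklore] -/
theorem firstHit_succ_of_none {p : ℕ → Bool} {j : ℕ} (hj : firstHit p j = none) : firstHit p (j + 1) = if p j then some j else none := by
  simp [firstHit, hj]

/-- The specification of `firstHit`. [folklore] -/
theorem firstHit_spec (p : ℕ → Bool) : ∀ j, (firstHit p j = none ∧ ∀ i < j, p i = false) ∨
    (∃ i, firstHit p j = some i ∧ i < j ∧ p i = true ∧ ∀ i' < i, p i' = false)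
  | 0 => Or.inl ⟨rfl, fun i hi => absurd hi (Nat.not_lt_zero _)⟩
  | j + 1 => by
    rcases firstHit_spec p j with ⟨hj, hall⟩ | ⟨i, hj, hij, hpi, hall⟩
    · rw [firstHit_succ_of_none hj]
      by_cases hp : p j = true
      · exact Or.inr ⟨j, by simp [hp], by omega, hp, hall⟩
      · refine Or.inl ⟨by simp [hp], fun i hi => ?_⟩
        rcases Nat.lt_succ_iff_lt_or_eq.1 hi with hi | rfl
        · exact hall i hi
        · simpa using hp
    · exact Or.inr ⟨i, firstHit_succ_of_some hj, by omega, hpi, hall⟩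

/-- The gcd predicate of the scans: `gcd(w_i, N) ≠ 1`. [folklore] -/
def gcdHit (N : ℕ) (ws : List ℕ) (i : ℕ) : Bool := decide (Nat.gcd (ws.getD i 0) N ≠ 1)

/-- The casework of the value scan on the gcd `γ` in `X4` (`X1 = 1`): `γ = 1`: nothing; else raise
`FL2`, and either (`γ = N`) record the index `BLC2` on `A1I` and raise `A1AI`, or record `γ` on `A1G`. [folklore] -/
def a1Case1 : NS β :=
  NS.seq (NS.op (.eq (h .X5) (h .X4) (h .X1) (h .X2)))
    (NS.ite (h .X5) NS.nop
      (NS.seq (NS.op (.const (h .FL2) [true]))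
        (NS.seq (NS.op (.eq (h .X6) (h .X4) (h (.g (.f (.n (.v .MD))))) (h .X2)))
          (NS.ite (h .X6) (NS.seq (NS.op (.copy (h .BLC2) (h .A1I))) (NS.op (.const (h .A1AI) [true])))
            (NS.op (.copy (h .X4) (h .A1G)))))))

/-- One value of the scan, guarded by `FL2`. [folklore] -/
def a1Scan1Body : Com (EReg ⊕ β) :=
  whenNot h .FL2
    (readItemTo (Sum.inr (h .BLOUT)) (Sum.inr (h .X3)) (Sum.inr (h (.g (.f (.n (.v .W)))))) (Sum.inr (h (.g (.f (.n (.v .TT)))))) ;;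
    (nGcd (h .X4) (h .X3) (h (.g (.f (.n (.v .MD))))) ;;
    ((a1Case1 h).com ;;
    ((NS.ofList [.clear (h .X3), .clear (h .X4), .succ (h .X4) (h .BLC2), .clear (h .BLC2), .move (h .X4) (h .BLC2)] : NS β).com))))

/-- The value scan: `X1 := 1`, `m` guarded rounds, clean-up of the unread values and the counter. [folklore] -/
def a1Scan1 : Com (EReg ⊕ β) :=
  ((NS.op (.const (h .X1) (encodeNat 1)) : NS β).com) ;;
  (nToUnary (h .U1) (h .BLM) ;;
  (countLoop (Sum.inr (h .U1)) (a1Scan1Body h) ;;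
  (clear (Sum.inr (h .BLOUT)) ;;
  ((NS.op (.clear (h .BLC2)) : NS β).com))))

/-- The state of the value scan after `j` values, `i` rounds to go: searching. [folklore] -/
def HSlots.srch1 (u : HSlots) (ws : List ℕ) (i j : ℕ) : HSlots :=
  { u with u1 := List.replicate i true, blout := encVec (ws.drop j), blc2 := encodeNat j }

/-- The state of the value scan after a hit at `i₀` with gcd `g`, `i` rounds to go. [folklore] -/
def HSlots.fnd1 (u : HSlots) (N : ℕ) (ws : List ℕ) (i i₀ g : ℕ) : HSlots :=
  { u with u1 := List.replicate i true, blout := encVec (ws.drop (i₀ + 1)), blc2 := encodeNat (i₀ + 1), fl2 := [true],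
           a1i := if g = N then encodeNat i₀ else u.a1i, a1ai := if g = N then [true] else u.a1ai, a1g := if g = N then u.a1g else encodeNat g }

/-- The state after the value scan. [folklore] -/
def HSlots.scan1Res (u : HSlots) (N : ℕ) (ws : List ℕ) (m : ℕ) : HSlots :=
  match firstHit (gcdHit N ws) m with
  | none => { u with x1 := encodeNat 1, blout := [] }
  | some i₀ => { (u.fnd1 N ws 0 i₀ (Nat.gcd (ws.getD i₀ 0) N)) with x1 := encodeNat 1, blout := [], blc2 := [] }

/-- Cost of the value scan. [folklore] -/
def a1Scan1Cost (n k m : ℕ) : ℕ := 4 * (n + 1) ^ 3 + ((k + 1) * (16 * 2 ^ k + 21) + 5) + (m * (1500 * (n + 1) ^ 3 + 2) + 1) + (2 * (2 ^ k * (2 * n)) + 1) + 3 * (n + 1) ^ 3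

/-- **The value scan.** [folklore] -/
theorem runs_a1Scan1 {N n k m : ℕ} (hN1 : 1 < N) (hn : (encodeNat N).length + 1 ≤ n) (hkn : 2 * k + 4 ≤ n) (T : Regs β) (hI : DrvInv (rGH h) N T)
    (u : HSlots) {ws : List ℕ} (hws : ws.length = m) (hwN : ∀ w ∈ ws, w < N) (hmk : m ≤ 2 ^ k) (hblout : u.blout = encVec ws) (hblm : u.blm = encodeNat m)
    (hx1 : u.x1 = []) (hx2 : u.x2 = []) (hx3 : u.x3 = []) (hx4 : u.x4 = []) (hx5 : u.x5 = []) (hx6 : u.x6 = []) (hu1 : u.u1 = []) (hblc2 : u.blc2 = [])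
    (hfl2 : u.fl2 = []) (ha1i : u.a1i = []) (ha1ai : u.a1ai = []) (ha1g : u.a1g = []) :
    Runs (a1Scan1 h) (base (hSt h T u)) (base (hSt h T (u.scan1Res N ws m))) (a1Scan1Cost n k m) := by
  have hhq : ∀ {i j : HReg}, i ≠ j → h i ≠ h j := fun hij => hq_ne h hij
  obtain ⟨hMD, -, -, -, -, -, hW, hTT, -, -, -, -, -, -, -, -, -, -⟩ := hI
  have hN0 : 0 < N := by omega
  set c := (n + 1) ^ 3 with hc3
  have hc1 : n + 1 ≤ c := by
    rw [hc3]; calc n + 1 = (n + 1) ^ 1 := (pow_one _).symm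
      _ ≤ (n + 1) ^ 3 := Nat.pow_le_pow_right (by omega) (by omega)
  have rdMD : ∀ u' : HSlots, hSt h T u' (h (.g (.f (.n (.v .MD))))) = encodeNat N := fun u' => by
    rw [hSt_gv h T u' (by decide) (by decide) (by decide) (by decide) (by decide) (by decide)]; exact hMD
  have rdW : ∀ u' : HSlots, hSt h T u' (h (.g (.f (.n (.v .W))))) = [] := fun u' => by
    rw [hSt_gv h T u' (by decide) (by decide) (by decide) (by decide) (by decide) (by decide)]; exact hW
  have rdTT : ∀ u' : HSlots, hSt h T u' (h (.g (.f (.n (.v .TT))))) = [] := fun u' => by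
    rw [hSt_gv h T u' (by decide) (by decide) (by decide) (by decide) (by decide) (by decide)]; exact hTT
  have hlN : (encodeNat N).length ≤ n := by omega
  have hN1' : N ≠ 1 := by omega
  have e1 : encodeNat 1 = [true] := by simpa using encodeNat_two_pow 0
  have hl1n : (encodeNat 1).length ≤ n := by rw [e1]; simp only [List.length_cons, List.length_nil]; omega
  have h2kk : 2 ^ k ≤ 2 ^ (2 * k) := Nat.pow_le_pow_right (by omega) (by omega)
  have hl2k : ∀ x, x ≤ 2 ^ (2 * k) → (encodeNat x).length ≤ n := fun x hx => length_le_of_le_two_pow_two_mul hx hkn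
  have hlm : (encodeNat m).length ≤ n := hl2k _ (hmk.trans h2kk)
  have hlws : ∀ j, (encVec (ws.drop j)).length ≤ 2 ^ k * (2 * n) := fun j =>
    (length_encVec_le_of_lt (fun x hx => hwN x (List.mem_of_mem_drop hx)) hn).trans (Nat.mul_le_mul_right _ (by rw [List.length_drop]; omega))
  -- X1 := 1, the unary count
  let u0 : HSlots := { u with x1 := encodeNat 1 }
  have h0 : Runs ((NS.op (.const (h .X1) (encodeNat 1))) : NS β).com (base (hSt h T u)) (base (hSt h T u0)) (4 * c) := by
    refine NS.runs_of_eq (N := n) _ _ ?_ (by simp [u0]) (by simp [hc3])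
    simp only [NS.ok, NOp.ok, hSt_X1, hx1, List.length_nil]; exact ⟨by omega, hl1n⟩
  have h1 : Runs (nToUnary (h .U1) (h .BLM)) (base (hSt h T u0)) (base (hSt h T (u0.srch1 ws m 0))) ((k + 1) * (16 * 2 ^ k + 21) + 5) := by
    refine (runs_nToUnary (h .U1) (h .BLM) (hSt h T u0) (by simp [u0, hu1])).of_eq ?_ ?_
    · simp [u0, HSlots.srch1, hblm, hblout, hblc2, show encodeNat 0 = [] from rfl]
    · simp only [hSt_BLM, u0, hblm, bitsToNat_encodeNat]; exact toUnary_cost_le hmk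
  -- the guarded body
  have hbodyA : ∀ i i₀ g, Runs (a1Scan1Body h) (base (hSt h T (u0.fnd1 N ws i i₀ g))) (base (hSt h T (u0.fnd1 N ws i i₀ g))) (1 + 2) :=
    fun i i₀ g => runs_whenNot_true h _ _ (by simp [HSlots.fnd1])
  have hbodyB : ∀ i j, j < m → Runs (a1Scan1Body h) (base (hSt h T (u0.srch1 ws i j)))
      (base (hSt h T (if gcdHit N ws j then u0.fnd1 N ws i j (Nat.gcd (ws.getD j 0) N) else u0.srch1 ws i (j + 1)))) (1500 * c) := by
    intro i j hj
    obtain ⟨w, l, hwl⟩ : ∃ w l, ws.drop j = w :: l := by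
      cases hd : ws.drop j with
      | nil => exact absurd (List.drop_eq_nil_iff.1 hd) (by omega)
      | cons a l => exact ⟨a, l, rfl⟩
    obtain ⟨hdrop', hgetD⟩ := drop_eq_cons_facts ws _ w l hwl
    have hw : w < N := hwN w (List.mem_of_mem_drop (l := ws) (i := j) (by rw [hwl]; simp))
    have hlw : (encodeNat w).length ≤ n := (Brick.length_encodeNat_mono hw.le).trans hlN
    have hgN : Nat.gcd w N ≤ N := Nat.gcd_le_right _ hN0
    have hlg : (encodeNat (Nat.gcd w N)).length ≤ n := (Brick.length_encodeNat_mono hgN).trans hlN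
    have hlj : (encodeNat j).length ≤ n := hl2k _ (by omega)
    have hlj1 : (encodeNat (j + 1)).length ≤ n := hl2k _ (by omega)
    have hpj : gcdHit N ws j = decide (Nat.gcd w N ≠ 1) := by rw [gcdHit, hgetD]
    let ua : HSlots := u0.srch1 ws i j
    let ub : HSlots := { ua with blout := encVec l, x3 := encodeNat w }
    let uc : HSlots := { ub with x4 := encodeNat (Nat.gcd w N) }
    have g1 : Runs (readItemTo (Sum.inr (h .BLOUT)) (Sum.inr (h .X3)) (Sum.inr (h (.g (.f (.n (.v .W)))))) (Sum.inr (h (.g (.f (.n (.v .TT)))))))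
        (base (hSt h T ua)) (base (hSt h T ub)) (11 * n + 9) := by
      refine (runs_readItemTo (by simp [hhq]) (by simp [hhq]) (by simp [hhq]) (by simp [hhq]) (by simp [hhq]) (encodeNat w) (encVec l)
        (base (hSt h T ua)) (by simp [ua, HSlots.srch1, hwl, encVec_cons]) (by simp [rdW]) (by simp [rdTT])).of_eq ?_ (by omega)
      simp [ua, ub, HSlots.srch1, u0, hx3]
    have g2 : Runs (nGcd (h .X4) (h .X3) (h (.g (.f (.n (.v .MD)))))) (base (hSt h T ub)) (base (hSt h T uc)) (1000 * c) := by
      refine (runs_nGcd (h .X4) (h .X3) (h (.g (.f (.n (.v .MD))))) (hSt h T ub) (x := w) (y := N) (n := n) (by simp [ub]) (rdMD ub) hlw hlN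
        (by simp [ub, ua, HSlots.srch1, u0, hx4])).of_eq ?_ (by simp [hc3])
      simp [ub, uc]
    -- the casework, by cases
    let ud : HSlots := { uc with fl2 := [true], a1i := if Nat.gcd w N = N then encodeNat j else uc.a1i, a1ai := if Nat.gcd w N = N then [true] else uc.a1ai, a1g := if Nat.gcd w N = N then uc.a1g else encodeNat (Nat.gcd w N) }
    have gcase : Runs (a1Case1 h).com (base (hSt h T uc)) (base (hSt h T (if Nat.gcd w N = 1 then uc else ud))) (400 * c) := by
      by_cases hg1 : Nat.gcd w N = 1
      · refine NS.runs_of_eq (N := n) _ _ ?_ ?_ ?_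
        · simp (config := { decide := true }) only [a1Case1, NS.ok, NOp.ok, NS.eval, NOp.eval, hSt_X1, hSt_X2, hSt_X4, hSt_X5, update_hSt_X5,
            uc, ub, ua, HSlots.srch1, u0, hx2, hx5, bitsToNat_encodeNat, hg1, ne_eq, EmbeddingLike.apply_eq_iff_eq,
            and_self, hl1n, not_false_eq_true, decide_true, flag_true, true_and, true_or]
        · simp [a1Case1, uc, ub, ua, HSlots.srch1, u0, hx2, hx5, hg1]
        · simp [hc3, a1Case1]
      · by_cases hgN' : Nat.gcd w N = N
        · refine NS.runs_of_eq (N := n) _ _ ?_ ?_ ?_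
          · simp (config := { decide := true }) only [a1Case1, NS.ok, NOp.ok, NS.eval, NOp.eval, hSt_X1, hSt_X2, hSt_X4, hSt_X5, hSt_X6, hSt_FL2, hSt_BLC2,
              hSt_A1I, hSt_A1AI, update_hSt_X5, update_hSt_X6, update_hSt_FL2, update_hSt_A1I, rdMD,
              uc, ub, ua, HSlots.srch1, u0, hx2, hx5, hx6, hfl2, ha1i, ha1ai, bitsToNat_encodeNat, hgN', hN1', ne_eq, EmbeddingLike.apply_eq_iff_eq,
              and_self, hl1n, hlN, hlj, not_false_eq_true, decide_true, decide_false, flag_true, flag_false, true_and,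
              and_true, false_or, List.length_cons, List.length_nil, zero_le]
            omega
          · simp [a1Case1, ud, uc, ub, ua, HSlots.srch1, u0, hx2, hx5, hx6, hfl2, ha1i, ha1ai, hgN', hN1', rdMD]
          · simp [hc3, a1Case1]
        · refine NS.runs_of_eq (N := n) _ _ ?_ ?_ ?_
          · simp (config := { decide := true }) only [a1Case1, NS.ok, NOp.ok, NS.eval, NOp.eval, hSt_X1, hSt_X2, hSt_X4, hSt_X5, hSt_X6, hSt_FL2,
              update_hSt_X5, update_hSt_X6, update_hSt_FL2, rdMD,
              uc, ub, ua, HSlots.srch1, u0, hx2, hx5, hx6, hfl2, ha1g, bitsToNat_encodeNat, hg1, hgN', ne_eq, EmbeddingLike.apply_eq_iff_eq,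
              List.length_nil, zero_le, and_self, hlg, hl1n, hlN, not_false_eq_true, decide_false, flag_false, true_and,
              and_true, or_true, false_or, List.length_cons]
            omega
          · simp [a1Case1, ud, uc, ub, ua, HSlots.srch1, u0, hx2, hx5, hx6, hfl2, ha1g, hg1, hgN', rdMD]
          · simp [hc3, a1Case1]
    have gtail : ∀ v : HSlots, v.x3 = encodeNat w → v.x4 = encodeNat (Nat.gcd w N) → v.blc2 = encodeNat j →
        Runs ((NS.ofList [.clear (h .X3), .clear (h .X4), .succ (h .X4) (h .BLC2), .clear (h .BLC2), .move (h .X4) (h .BLC2)] : NS β).com)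
          (base (hSt h T v)) (base (hSt h T { v with x3 := [], x4 := [], blc2 := encodeNat (j + 1) })) (89 * c) := by
      intro v h3 h4 h5
      refine NS.runs_of_eq (N := n) _ _ ?_ ?_ (by simp [hc3])
      · simp (config := { decide := true }) only [NS.ofList, NS.ok, NOp.ok, NS.eval, NOp.eval, hSt_X3, hSt_X4, hSt_BLC2, update_hSt_X3, update_hSt_X4,
          update_hSt_BLC2, h3, h4, h5, bitsToNat_encodeNat, ne_eq, EmbeddingLike.apply_eq_iff_eq, List.length_nil, zero_le, and_self, hlw, hlg, hlj, hlj1,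
          not_false_eq_true]
      · simp [h4, h5]
    have hstart : hSt h T ua (h .FL2) = [] := by simp [ua, HSlots.srch1, u0, hfl2]
    by_cases hg1 : Nat.gcd w N = 1
    · rw [if_pos hg1] at gcase
      have hpf : gcdHit N ws j = false := by rw [hpj]; simp [hg1]
      rw [hpf]
      refine (runs_whenNot_nil h (hSt h T ua) hstart (g1.seq (g2.seq (gcase.seq (gtail uc rfl rfl rfl))))).of_eq ?_ (by omega)
      simp [uc, ub, ua, HSlots.srch1, hdrop', hx3, hx4, u0]
    · rw [if_neg hg1] at gcase
      have hpt : gcdHit N ws j = true := by rw [hpj]; simp [hg1]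
      rw [hpt]
      refine (runs_whenNot_nil h (hSt h T ua) hstart (g1.seq (g2.seq (gcase.seq (gtail ud rfl rfl rfl))))).of_eq ?_ (by omega)
      have hgetD' : ws[j]?.getD 0 = w := by rw [← List.getD_eq_getElem?_getD]; exact hgetD
      simp [ud, uc, ub, ua, HSlots.srch1, HSlots.fnd1, hdrop', hgetD', hx3, hx4, u0]
  -- the loop
  have hL := runs_countLoop (U := (Sum.inr (h .U1) : EReg ⊕ β)) (body := a1Scan1Body h)
    (fun i R => (firstHit (gcdHit N ws) (m - i) = none ∧ i ≤ m ∧ R = base (hSt h T (u0.srch1 ws i (m - i)))) ∨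
      (∃ i₀, firstHit (gcdHit N ws) (m - i) = some i₀ ∧ i ≤ m ∧ R = base (hSt h T (u0.fnd1 N ws i i₀ (Nat.gcd (ws.getD i₀ 0) N)))))
    (1500 * c)
    (by
      rintro i R (⟨hfh, him, rfl⟩ | ⟨i₀, hfh, him, rfl⟩) -
      · have hupd : Function.update (base (hSt h T (u0.srch1 ws (i + 1) (m - (i + 1))))) (Sum.inr (h .U1)) (List.replicate i true) =
            base (hSt h T (u0.srch1 ws i (m - (i + 1)))) := by simp [HSlots.srch1]
        rw [hupd]
        refine ⟨_, hbodyB i (m - (i + 1)) (by omega), ?_, ?_⟩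
        · split_ifs <;> simp [HSlots.srch1, HSlots.fnd1]
        · have hj : m - i = m - (i + 1) + 1 := by omega
          rw [hj, firstHit_succ_of_none hfh]
          by_cases hp : gcdHit N ws (m - (i + 1)) = true
          · right; exact ⟨m - (i + 1), by simp [hp], by omega, by simp [hp]⟩
          · left; exact ⟨by simp [hp], by omega, by simp [hp]⟩
      · have hupd : Function.update (base (hSt h T (u0.fnd1 N ws (i + 1) i₀ (Nat.gcd (ws.getD i₀ 0) N)))) (Sum.inr (h .U1)) (List.replicate i true) =
            base (hSt h T (u0.fnd1 N ws i i₀ (Nat.gcd (ws.getD i₀ 0) N))) := by simp [HSlots.fnd1]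
        rw [hupd]
        refine ⟨_, (hbodyA i i₀ _).mono (by omega), by simp [HSlots.fnd1], ?_⟩
        right
        have hj : m - i = m - (i + 1) + 1 := by omega
        exact ⟨i₀, by rw [hj, firstHit_succ_of_some hfh], by omega, rfl⟩)
    m (base (hSt h T (u0.srch1 ws m 0))) (Or.inl ⟨by simp [firstHit], le_rfl, by simp⟩) (by simp [HSlots.srch1])
  obtain ⟨R', hR, -, hP⟩ := hL
  simp only [Nat.sub_zero] at hP
  -- clean-up
  have hfinish : ∀ (v : HSlots) (rest : List ℕ) (jj : ℕ), (∀ x ∈ rest, x < N) → rest.length ≤ 2 ^ k → v.blout = encVec rest → v.blc2 = encodeNat jj → jj ≤ 2 ^ k →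
      Runs (clear (Sum.inr (h .BLOUT)) ;; ((NS.op (.clear (h .BLC2)) : NS β).com)) (base (hSt h T v))
        (base (hSt h T { v with blout := [], blc2 := [] })) ((2 * (2 ^ k * (2 * n)) + 1) + 3 * c) := by
    intro v rest jj hrN hrl hvb hvc hjj
    have hl : (encVec rest).length ≤ 2 ^ k * (2 * n) := (length_encVec_le_of_lt hrN hn).trans (Nat.mul_le_mul_right _ hrl)
    have q1 : Runs (clear (Sum.inr (h .BLOUT))) (base (hSt h T v)) (base (hSt h T { v with blout := [] })) (2 * (2 ^ k * (2 * n)) + 1) := by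
      refine (runs_clear (Sum.inr (h .BLOUT)) (base (hSt h T v))).of_eq (by simp) ?_
      simp only [nst_inr, hSt_BLOUT, hvb]; omega
    have q2 : Runs ((NS.op (.clear (h .BLC2)) : NS β).com) (base (hSt h T { v with blout := [] })) (base (hSt h T { v with blout := [], blc2 := [] })) (3 * c) := by
      refine NS.runs_of_eq (N := n) _ _ ?_ (by simp) (by simp [hc3])
      simp only [NS.ok, NOp.ok, hSt_BLC2, hvc]; exact hl2k _ (hjj.trans h2kk)
    exact q1.seq q2
  rcases hP with ⟨hfh, -, rfl⟩ | ⟨i₀, hfh, -, rfl⟩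
  · have hf := hfinish (u0.srch1 ws 0 m) (ws.drop m) m (fun x hx => hwN x (List.mem_of_mem_drop hx)) (by rw [List.length_drop]; omega)
      (by simp [HSlots.srch1]) (by simp [HSlots.srch1]) hmk
    refine (h0.seq (h1.seq (hR.seq hf))).of_eq ?_ ?_
    · simp only [HSlots.scan1Res, hfh]
      simp [HSlots.srch1, u0, hu1, hblc2]
    · simp only [a1Scan1Cost, ← hc3]; omega
  · rcases firstHit_spec (gcdHit N ws) m with ⟨hnone, -⟩ | ⟨i₁, hsome, hi₁m, -, -⟩
    · rw [hfh] at hnone; exact absurd hnone (by simp)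
    rw [hfh] at hsome
    obtain rfl : i₀ = i₁ := Option.some.inj hsome
    have hf := hfinish (u0.fnd1 N ws 0 i₀ (Nat.gcd (ws.getD i₀ 0) N)) (ws.drop (i₀ + 1)) (i₀ + 1) (fun x hx => hwN x (List.mem_of_mem_drop hx))
      (by rw [List.length_drop]; omega) (by simp [HSlots.fnd1]) (by simp [HSlots.fnd1]) (by omega)
    refine (h0.seq (h1.seq (hR.seq hf))).of_eq ?_ ?_
    · simp only [HSlots.scan1Res, hfh]
      simp [HSlots.fnd1, u0]
    · simp only [a1Scan1Cost, ← hc3]; omega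

/-! #### The scan over the values `v_h` at the hit `i` -/

/-- The residues `(P + N − v_h) mod N` of the point `P` against the values. [folklore] -/
def a1Resids (N P : ℕ) (vs : List ℕ) : List ℕ := vs.map fun v => (P + N - v) % N

/-- One residue: read `v_h`, `(P + N − v_h) mod N`, emit. [folklore] -/
def a1ResidBody : Com (EReg ⊕ β) :=
  readItemTo (Sum.inr (h .L1)) (Sum.inr (h .X3)) (Sum.inr (h (.g (.f (.n (.v .W)))))) (Sum.inr (h (.g (.f (.n (.v .TT)))))) ;;
  (((NS.ofList [.add (h .X4) (h .X5) (h (.g (.f (.n (.v .MD))))), .sub (h .X6) (h .X4) (h .X3), .clear (h .X4), .clear (h .X3),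
      .divMod (h .X4) (h .X2) (h .X6) (h (.g (.f (.n (.v .MD))))), .clear (h .X4), .clear (h .X6)] : NS β).com) ;;
  emit (Sum.inr (h .X2)) (Sum.inr (h .L4)))

/-- The residue pass: all of `L1` onto `BLOUT`. [folklore] -/
def a1Resid : Com (EReg ⊕ β) :=
  streamLoop (Sum.inr (h .L1)) (Sum.inr (h .FL1)) (a1ResidBody h) ;; (pour (Sum.inr (h .L4)) (Sum.inr (h .BLOUT)) ;; ((NS.op (.clear (h .X5)) : NS β).com))

/-- Cost of the residue pass on `V` values. [folklore] -/
def a1ResidCost (n V : ℕ) : ℕ := V * (1000 * (n + 1) ^ 3) + 6 * V + 4 + (3 * (V * (2 * n)) + 1) + 3 * (n + 1) ^ 3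

/-- **The residue pass.** [folklore] -/
theorem runs_a1Resid {N n P : ℕ} (hN1 : 1 < N) (hn : (encodeNat N).length + 1 ≤ n) (T : Regs β) (hI : DrvInv (rGH h) N T)
    (u : HSlots) {vs : List ℕ} (hvN : ∀ v ∈ vs, v < N) (hP : P < N) (hl1 : u.l1 = encVec vs) (hx5 : u.x5 = encodeNat P)
    (hx2 : u.x2 = []) (hx3 : u.x3 = []) (hx4 : u.x4 = []) (hx6 : u.x6 = []) (hfl1 : u.fl1 = []) (hl4 : u.l4 = []) (hblout : u.blout = []) :
    Runs (a1Resid h) (base (hSt h T u)) (base (hSt h T { u with l1 := [], x5 := [], blout := encVec (a1Resids N P vs) })) (a1ResidCost n vs.length) := by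
  have hhq : ∀ {i j : HReg}, i ≠ j → h i ≠ h j := fun hij => hq_ne h hij
  obtain ⟨hMD, -, -, -, -, -, hW, hTT, -, -, -, -, -, -, -, -, -, -⟩ := hI
  have hN0 : 0 < N := by omega
  set c := (n + 1) ^ 3 with hc3
  have hc1 : n + 1 ≤ c := by
    rw [hc3]; calc n + 1 = (n + 1) ^ 1 := (pow_one _).symm
      _ ≤ (n + 1) ^ 3 := Nat.pow_le_pow_right (by omega) (by omega)
  have rdMD : ∀ u' : HSlots, hSt h T u' (h (.g (.f (.n (.v .MD))))) = encodeNat N := fun u' => by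
    rw [hSt_gv h T u' (by decide) (by decide) (by decide) (by decide) (by decide) (by decide)]; exact hMD
  have rdW : ∀ u' : HSlots, hSt h T u' (h (.g (.f (.n (.v .W))))) = [] := fun u' => by
    rw [hSt_gv h T u' (by decide) (by decide) (by decide) (by decide) (by decide) (by decide)]; exact hW
  have rdTT : ∀ u' : HSlots, hSt h T u' (h (.g (.f (.n (.v .TT))))) = [] := fun u' => by
    rw [hSt_gv h T u' (by decide) (by decide) (by decide) (by decide) (by decide) (by decide)]; exact hTT
  have hlN : (encodeNat N).length ≤ n := by omega
  have hlP : (encodeNat P).length ≤ n := (Brick.length_encodeNat_mono hP.le).trans hlN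
  have hl2N : ∀ x, x ≤ 2 * N → (encodeNat x).length ≤ n := fun x hx =>
    (Brick.length_encodeNat_mono hx).trans (by rw [encodeNat_two_mul _ hN0]; simp only [List.length_cons]; omega)
  let st : List ℕ → List ℕ → HSlots := fun done l => { u with l1 := encVec l, l4 := outRev ((a1Resids N P done).map encodeNat) }
  have hbody : ∀ (v : ℕ) (l done : List ℕ), v ∈ vs → Runs (a1ResidBody h) (base (hSt h T (st done (v :: l)))) (base (hSt h T (st (done ++ [v]) l))) (1000 * c) := by
    intro v l done hv
    have hvN' := hvN v hv
    have hlv : (encodeNat v).length ≤ n := (Brick.length_encodeNat_mono hvN'.le).trans hlN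
    have hl1' : (encodeNat (P + N)).length ≤ n := hl2N _ (by omega)
    have hl2' : (encodeNat (P + N - v)).length ≤ n := hl2N _ (by omega)
    have hl3' : (encodeNat ((P + N - v) / N)).length ≤ n := hl2N _ ((Nat.div_le_self _ _).trans (by omega))
    have hl4' : (encodeNat ((P + N - v) % N)).length ≤ n := (Brick.length_encodeNat_mono (Nat.mod_lt _ hN0).le).trans hlN
    have hvle : v ≤ P + N := by omega
    let ua := st done (v :: l)
    let ub : HSlots := { ua with l1 := encVec l, x3 := encodeNat v }
    let uc : HSlots := { ub with x3 := [], x2 := encodeNat ((P + N - v) % N) }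
    have g1 : Runs (readItemTo (Sum.inr (h .L1)) (Sum.inr (h .X3)) (Sum.inr (h (.g (.f (.n (.v .W)))))) (Sum.inr (h (.g (.f (.n (.v .TT)))))))
        (base (hSt h T ua)) (base (hSt h T ub)) (11 * n + 9) := by
      refine (runs_readItemTo (by simp [hhq]) (by simp [hhq]) (by simp [hhq]) (by simp [hhq]) (by simp [hhq]) (encodeNat v) (encVec l)
        (base (hSt h T ua)) (by simp [ua, st, encVec_cons]) (by simp [rdW]) (by simp [rdTT])).of_eq ?_ (by omega)
      simp [ua, ub, st, hx3]
    have g2 : Runs ((NS.ofList [.add (h .X4) (h .X5) (h (.g (.f (.n (.v .MD))))), .sub (h .X6) (h .X4) (h .X3), .clear (h .X4), .clear (h .X3),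
        .divMod (h .X4) (h .X2) (h .X6) (h (.g (.f (.n (.v .MD))))), .clear (h .X4), .clear (h .X6)] : NS β).com) (base (hSt h T ub)) (base (hSt h T uc)) (501 * c) := by
      refine NS.runs_of_eq (N := n) _ _ ?_ ?_ (by simp [hc3])
      · simp (config := { decide := true }) only [NS.ofList, NS.ok, NOp.ok, NS.eval, NOp.eval, hSt_X2, hSt_X3, hSt_X4, hSt_X5, hSt_X6,
          update_hSt_X2, update_hSt_X3, update_hSt_X4, update_hSt_X6, ub, ua, st, hx2, hx4, hx5, hx6, rdMD, bitsToNat_encodeNat, ne_eq,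
          EmbeddingLike.apply_eq_iff_eq, List.length_nil, zero_le, and_self, hlP, hlN, hlv, hl1', hl2', hl3', hvle, hN0, not_false_eq_true]
      · simp [ub, uc, ua, st, hx2, hx4, hx5, hx6, rdMD]
    have g3 : Runs (emit (Sum.inr (h .X2)) (Sum.inr (h .L4))) (base (hSt h T uc)) (base (hSt h T (st (done ++ [v]) l))) (4 * n + 3) := by
      refine (runs_emit (h := (Sum.inr (h .X2) : EReg ⊕ β)) (o := Sum.inr (h .L4)) (by simp [hhq]) (base (hSt h T uc))).of_eq ?_ ?_
      · simp [uc, ub, ua, st, hx2, hx3, a1Resids, List.map_append, outRev_append]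
      · simp only [nst_inr, hSt_X2, uc]; omega
    exact (g1.seq (g2.seq g3)).mono (by omega)
  have hloop := runs_streamLoop (L := (Sum.inr (h .L1) : EReg ⊕ β)) (w := Sum.inr (h .FL1)) (by simp [hhq]) (body := a1ResidBody h)
    encVec (by simp [encVec]) (fun a l => by simp [encVec_cons])
    (fun l R => ∃ done, done ++ l = vs ∧ R = base (hSt h T (st done l)))
    (fun _ => 1000 * c)
    (by
      rintro a l R ⟨done, hdl, rfl⟩ - -
      have ha : a ∈ vs := by rw [← hdl]; simp
      exact ⟨_, hbody a l done ha, by simp [st], by simp [st, hfl1], done ++ [a], by simpa using hdl, rfl⟩)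
    vs (base (hSt h T u)) ⟨[], by simp, by simp [st, a1Resids, ← hl1, ← hl4]⟩ (by simp [hl1]) (by simp [hfl1])
  obtain ⟨R', hL, -, -, done, hdone, rfl⟩ := hloop
  simp only [List.append_nil] at hdone
  subst hdone
  set Rs := a1Resids N P done with hRs0
  have hRsN : ∀ x ∈ Rs, x < N := fun x hx => by
    simp only [hRs0, a1Resids, List.mem_map] at hx; obtain ⟨v, -, rfl⟩ := hx; exact Nat.mod_lt _ hN0
  have hRsl : Rs.length = done.length := by simp [hRs0, a1Resids]
  have hrev : (outRev (Rs.map encodeNat)).reverse = encVec Rs := by rw [reverse_outRev]; rfl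
  have hlo : (outRev (Rs.map encodeNat)).length ≤ done.length * (2 * n) := by
    rw [← List.length_reverse, hrev, ← hRsl]; exact length_encVec_le_of_lt hRsN hn
  have p1 : Runs (pour (Sum.inr (h .L4)) (Sum.inr (h .BLOUT))) (base (hSt h T (st done []))) (base (hSt h T { st done [] with l4 := [], blout := encVec Rs }))
      (3 * (done.length * (2 * n)) + 1) := by
    refine (runs_opour (a := h .L4) (b := h .BLOUT) (hhq (by decide)) (hSt h T (st done []))).of_eq ?_ ?_
    · simp [st, hrev, hblout, ← hRs0]
    · simp only [hSt_L4, st, ← hRs0]; omega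
  have p2 : Runs ((NS.op (.clear (h .X5)) : NS β).com) (base (hSt h T { st done [] with l4 := [], blout := encVec Rs }))
      (base (hSt h T { u with l1 := [], x5 := [], blout := encVec Rs })) (3 * c) := by
    refine NS.runs_of_eq (N := n) _ _ (by simp only [NS.ok, NOp.ok, hSt_X5, st, hx5]; exact hlP) ?_ (by simp [hc3])
    simp [st, hl4, encVec]
  refine (hL.seq (p1.seq p2)).of_eq rfl ?_
  simp only [a1ResidCost, List.map_const', List.sum_replicate, smul_eq_mul, ← hc3]
  omega

/-- The prelude of the second scan: the point `P = α^i · c` into `X5`, the bookkeeping of the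
first scan's outcome (`BLG := i`, `BLFP := 1`), the registers of the value scan reset, `BLM := 2^e`. [folklore] -/
def a1Prelude : Com (EReg ⊕ β) :=
  ((NS.ofList [.powMod (h .X5) (h .BLA) (h .A1I) (h (.g (.f (.n (.v .MD))))), .mulMod (h .X5) (h .A1C) (h (.g (.f (.n (.v .MD))))),
      .clear (h .A1AI), .const (h .BLFP) [true], .move (h .A1I) (h .BLG), .clear (h .FL2), .clear (h .X1), .clear (h .BLM)] : NS β).com) ;;
  pow2Into (rGH h) (h .BLM) (h .A1P)

/-- The second scan: at a hit `i` of the value scan with gcd `N`, the residues of `α^i c` against the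
values are scanned by the value scan itself. [folklore] -/
def a1Scan2 : Com (EReg ⊕ β) :=
  whenTrue h .A1AI (a1Prelude h ;; (a1Resid h ;; a1Scan1 h))

/-- Cost of the second scan. [folklore] -/
def a1Scan2Cost (n e : ℕ) : ℕ :=
  1 + (2874 * (n + 1) ^ 3 + (n * (16 * e + 21) + 3 * e + 7) + (a1ResidCost n (2 ^ e) + a1Scan1Cost n e (2 ^ e))) + 2

/-- **The second scan, when the value scan hit the gcd `N` at `i`.** [folklore] -/
theorem runs_a1Scan2_true {N n e k α cc i : ℕ} (hN1 : 1 < N) (hn : (encodeNat N).length + 1 ≤ n) (hen : 2 * e + 4 ≤ n) (hkn : 2 * k + 4 ≤ n)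
    (T : Regs β) (hI : DrvInv (rGH h) N T) (u : HSlots) {vs : List ℕ} (hvs : vs.length = 2 ^ e) (hvN : ∀ v ∈ vs, v < N) (hαN : α < N) (hcN : cc < N)
    (hik : i < 2 ^ k) (hl1 : u.l1 = encVec vs) (hbla : u.bla = encodeNat α) (ha1c : u.a1c = encodeNat cc) (ha1i : u.a1i = encodeNat i) (ha1ai : u.a1ai = [true])
    (ha1p : u.a1p = encodeNat e) {bm x1v : List Bool} (hblm : u.blm = bm) (hbm : bm.length ≤ n) (hx1 : u.x1 = x1v) (hx1v : x1v.length ≤ n)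
    (hfl2 : u.fl2 = [true]) (hblg : u.blg = []) (hblfp : u.blfp = []) (ha1g : u.a1g = [])
    (hx2 : u.x2 = []) (hx3 : u.x3 = []) (hx4 : u.x4 = []) (hx5 : u.x5 = []) (hx6 : u.x6 = []) (hu1 : u.u1 = []) (hblc2 : u.blc2 = [])
    (hfl1 : u.fl1 = []) (hl4 : u.l4 = []) (hblout : u.blout = []) :
    Runs (a1Scan2 h) (base (hSt h T u))
      (base (hSt h T (HSlots.scan1Res { u with l1 := [], a1i := [], a1ai := [], blfp := [true], blg := encodeNat i, fl2 := [], x1 := [], blm := encodeNat (2 ^ e) } N (a1Resids N (α ^ i % N * cc % N) vs) (2 ^ e))))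
      (a1Scan2Cost n e) := by
  have hhq : ∀ {i j : HReg}, i ≠ j → h i ≠ h j := fun hij => hq_ne h hij
  obtain ⟨hMD, -, -, -, -, -, -, -, -, -, hU, -, -, -, -, -, -, -⟩ := id hI
  have hN0 : 0 < N := by omega
  set c := (n + 1) ^ 3 with hc3
  have rdMD : ∀ u' : HSlots, hSt h T u' (h (.g (.f (.n (.v .MD))))) = encodeNat N := fun u' => by
    rw [hSt_gv h T u' (by decide) (by decide) (by decide) (by decide) (by decide) (by decide)]; exact hMD
  have rdU : ∀ u' : HSlots, hSt h T u' (h (.g (.f (.n (.v .U))))) = [] := fun u' => by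
    rw [hSt_gv h T u' (by decide) (by decide) (by decide) (by decide) (by decide) (by decide)]; exact hU
  have hlN : (encodeNat N).length ≤ n := by omega
  have hlα : (encodeNat α).length ≤ n := (Brick.length_encodeNat_mono hαN.le).trans hlN
  have hlc : (encodeNat cc).length ≤ n := (Brick.length_encodeNat_mono hcN.le).trans hlN
  have hli : (encodeNat i).length ≤ n := length_le_of_le_two_pow_two_mul (hik.le.trans (Nat.pow_le_pow_right (by omega) (by omega))) hkn
  have hle : (encodeNat e).length ≤ n := (length_encodeNat_le_succ (le_two_pow_self e)).trans (by omega)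
  have hlp1 : (encodeNat (α ^ i % N)).length ≤ n := (Brick.length_encodeNat_mono (Nat.mod_lt _ hN0).le).trans hlN
  set P := α ^ i % N * cc % N with hP0
  have hPN : P < N := Nat.mod_lt _ hN0
  -- prelude
  let u1 : HSlots := { u with x5 := encodeNat P, a1ai := [], blfp := [true], a1i := [], blg := encodeNat i, fl2 := [], x1 := [], blm := [] }
  have h1 : Runs ((NS.ofList [.powMod (h .X5) (h .BLA) (h .A1I) (h (.g (.f (.n (.v .MD))))), .mulMod (h .X5) (h .A1C) (h (.g (.f (.n (.v .MD))))),
      .clear (h .A1AI), .const (h .BLFP) [true], .move (h .A1I) (h .BLG), .clear (h .FL2), .clear (h .X1), .clear (h .BLM)] : NS β).com)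
      (base (hSt h T u)) (base (hSt h T u1)) (2874 * c) := by
    refine NS.runs_of_eq (N := n) _ _ ?_ ?_ (by simp [hc3])
    · simp (config := { decide := true }) only [NS.ofList, NS.ok, NOp.ok, NS.eval, NOp.eval, hSt_X5, hSt_BLA, hSt_A1I, hSt_A1C, hSt_A1AI, hSt_BLFP, hSt_BLG,
        hSt_FL2, hSt_X1, hSt_BLM, update_hSt_X5, update_hSt_A1AI, update_hSt_BLFP, update_hSt_A1I, update_hSt_BLG, update_hSt_FL2, update_hSt_X1,
        hx5, hbla, ha1i, ha1c, ha1ai, hblfp, hblg, hfl2, hx1, hblm, rdMD, bitsToNat_encodeNat, ne_eq, EmbeddingLike.apply_eq_iff_eq,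
        List.length_nil, List.length_cons, zero_le, and_self, hlα, hli, hlc, hlN, hlp1, hN1, hN0, hbm, hx1v, not_false_eq_true]
      simp only [true_and, and_true, zero_add, and_self]; omega
    · simp [u1, hbla, ha1i, ha1c, ha1ai, hblfp, hblg, hfl2, hx1, hblm, rdMD, hP0]
  let u2 : HSlots := { u1 with blm := encodeNat (2 ^ e) }
  have h2 : Runs (pow2Into (rGH h) (h .BLM) (h .A1P)) (base (hSt h T u1)) (base (hSt h T u2)) (n * (16 * e + 21) + 3 * e + 7) := by
    have hne : h .BLM ≠ h .A1P := hhq (by decide)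
    have hneU : h .BLM ≠ (rGH h) (.f (.n (.v .U))) := (rGH_ne h .BLM (fun _ e => HReg.noConfusion e) _).symm
    have r1 : hSt h T u1 (h .A1P) = encodeNat e := by rw [hSt_A1P]; exact ha1p
    have r2 : hSt h T u1 (h .BLM) = [] := by rw [hSt_BLM]
    refine (runs_pow2Into (rGH h) hneU hne hle (hSt h T u1) r1 r2 (rdU u1)).of_eq ?_ le_rfl
    rw [update_hSt_BLM]
  -- residues, then the value scan on them
  have h3 := runs_a1Resid h hN1 hn T hI u2 hvN hPN (by simp [u2, u1, hl1]) (by simp [u2, u1]) (by simp [u2, u1, hx2]) (by simp [u2, u1, hx3])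
    (by simp [u2, u1, hx4]) (by simp [u2, u1, hx6]) (by simp [u2, u1, hfl1]) (by simp [u2, u1, hl4]) (by simp [u2, u1, hblout])
  have hRl : (a1Resids N P vs).length = 2 ^ e := by simp [a1Resids, hvs]
  have hRN : ∀ x ∈ a1Resids N P vs, x < N := fun x hx => by
    simp only [a1Resids, List.mem_map] at hx; obtain ⟨v, -, rfl⟩ := hx; exact Nat.mod_lt _ hN0
  have h4 := runs_a1Scan1 h hN1 hn hen T hI { u2 with l1 := [], x5 := [], blout := encVec (a1Resids N P vs) } hRl hRN le_rfl (by simp) (by simp [u2])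
    (by simp [u2, u1]) (by simp [u2, u1, hx2]) (by simp [u2, u1, hx3]) (by simp [u2, u1, hx4]) (by simp) (by simp [u2, u1, hx6]) (by simp [u2, u1, hu1])
    (by simp [u2, u1, hblc2]) (by simp [u2, u1]) (by simp [u2, u1]) (by simp [u2, u1]) (by simp [u2, u1, ha1g])
  rw [hvs] at h3
  refine (runs_whenTrue_true h (hSt h T u) (by rw [hSt_A1AI]; exact ha1ai) ((h1.seq h2).seq (h3.seq h4))).of_eq ?_ ?_
  · simp only [HSlots.scan1Res]
    split <;> simp [u2, u1, hx5, HSlots.fnd1]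
  · simp only [a1Scan2Cost, ← hc3]; omega

/-- **The second scan, when the value scan did not ask for it.** [folklore] -/
theorem runs_a1Scan2_nil (T : Regs β) (u : HSlots) (ha1ai : u.a1ai = []) : Runs (a1Scan2 h) (base (hSt h T u)) (base (hSt h T u)) (0 + 2) :=
  runs_whenTrue_nil h _ _ (by rw [hSt_A1AI]; exact ha1ai)

/-! #### Algorithm 1 assembled -/

/-- The clean-up: the copy of the values, the constant `1`, the count, the stop flag. [folklore] -/
def a1Cleanup : Com (EReg ⊕ β) :=
  clear (Sum.inr (h .L1)) ;; ((NS.ofList [.clear (h .X1), .clear (h .BLM), .clear (h .FL2)] : NS β).com)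

/-- **Algorithm 1** on the machine. [folklore] -/
def alg1 : Com (EReg ⊕ β) :=
  a1Tree h ;; (a1Coef h ;; (bluestein h ;; (a1Scan1 h ;; (a1Scan2 h ;; a1Cleanup h))))

/-- The outcome of Algorithm 1 as computed by the machine: the factor found (if any), the index `i`
of a value with gcd `N` (if the value scan stopped there), and the index `h` of an exact match
`v_h ≡ α^i c (mod N)` found by the second scan (if any). [folklore] -/
def alg1Out (N α cc m k e : ℕ) (b : List ℕ) (vs : List ℕ) : Option ℕ × Option ℕ × Option ℕ :=
  let ws := NegFFT.bluesteinValues N α m k (a1Coefs N cc b (2 ^ e + 1))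
  match firstHit (gcdHit N ws) m with
  | none => (none, none, none)
  | some i₀ =>
    if Nat.gcd (ws.getD i₀ 0) N = N then
      let rs := a1Resids N (α ^ i₀ % N * cc % N) vs
      match firstHit (gcdHit N rs) (2 ^ e) with
      | none => (none, some i₀, none)
      | some h₀ => if Nat.gcd (rs.getD h₀ 0) N = N then (none, some i₀, some h₀) else (some (Nat.gcd (rs.getD h₀ 0) N), some i₀, none)
    else (some (Nat.gcd (ws.getD i₀ 0) N), none, none)

/-- The coded optional numeral. [folklore] -/
def encOpt : Option ℕ → List Bool
  | none => []
  | some x => encodeNat x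

/-- The coded flag of an option. [folklore] -/
def flagOpt : Option ℕ → List Bool
  | none => []
  | some _ => [true]

/-- The registers after Algorithm 1, from its outcome. [folklore] -/
def HSlots.alg1Final (u : HSlots) (o : Option ℕ × Option ℕ × Option ℕ) : HSlots :=
  { u with a1v := [], l1 := [], x1 := [], blm := [], fl2 := [], blout := [], ptk := [], ptu := [], blf := [],
           a1g := encOpt o.1, blfp := flagOpt o.2.1, blg := encOpt o.2.1, a1ai := flagOpt o.2.2, a1i := encOpt o.2.2 }

/-- Cost of Algorithm 1. [folklore] -/
def alg1Cost (n e k m : ℕ) : ℕ :=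
  a1TreeCost n e + (a1CoefCost n e + (bluesteinCost n k (2 ^ e + 1) + (a1Scan1Cost n k m + (a1Scan2Cost n e + ((2 * (2 ^ e * (2 * n)) + 1) + 9 * (n + 1) ^ 3)))))

/-- **Algorithm 1 on the machine**: the registers at the end are the function `alg1Out` of the inputs. [folklore] -/
theorem runs_alg1 {N e n k α cc m : ℕ} (hNodd : Odd N) (hN1 : 1 < N) (hn : (encodeNat N).length + 1 ≤ n) (hen : 2 * e + 6 ≤ n) (hk : 1 ≤ k)
    (hkn : 2 * k + 4 ≤ n) (hm : 1 ≤ m) (hkm : 2 ^ e + m ≤ 2 ^ (k - 1)) (hαN : α < N) (hcN : cc < N)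
    (T : Regs β) (hI : DrvInv (rGH h) N T) (hCI : T (h (.g .CINV)) = encodeNat (NegFFT.inv2N N))
    (u : HSlots) (hw : u.gw.Clean) (hsched : u.gw.sched = []) (hhist : u.gw.hist = []) (hbg : u.gw.bg = []) (hkn' : u.gw.kn = []) (hbf : u.gw.bf = [])
    {vs : List ℕ} (hvs : vs.length = 2 ^ e) (hvN : ∀ v ∈ vs, v < N) {b : List ℕ} (hb : NegFFT.prodTreeH N e vs = [b])
    (ha1v : u.a1v = encVec vs) (ha1p : u.a1p = encodeNat e) (hbla : u.bla = encodeNat α) (ha1c : u.a1c = encodeNat cc) (hblm : u.blm = encodeNat m)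
    (hblk : u.blk = encodeNat k) (hblpow : u.blpow = encodeNat 2)
    (hl1 : u.l1 = []) (hx1 : u.x1 = []) (hx2 : u.x2 = []) (hx3 : u.x3 = []) (hx4 : u.x4 = []) (hx5 : u.x5 = []) (hx6 : u.x6 = [])
    (hfl1 : u.fl1 = []) (hfl2 : u.fl2 = []) (hu1 : u.u1 = []) (hl4 : u.l4 = []) (hptk : u.ptk = []) (hptu : u.ptu = []) (hblf : u.blf = [])
    (hble : u.ble = []) (hblc1 : u.blc1 = []) (hblc2 : u.blc2 = []) (hblout : u.blout = []) (ha1i : u.a1i = []) (ha1ai : u.a1ai = []) (ha1g : u.a1g = [])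
    (hblg : u.blg = []) (hblfp : u.blfp = []) :
    Runs (alg1 h) (base (hSt h T u)) (base (hSt h T (u.alg1Final (alg1Out N α cc m k e b vs)))) (alg1Cost n e k m) := by
  obtain ⟨hkd, har, hlvn, hlvu, hmreg, htreg, hhn0, hm20, hm40, hlen0, htw2, htws, htw3, htmph, hout, htwout, hcc, hw0, hrr, hfz⟩ := id hw
  have hN0 : 0 < N := by omega
  set c := (n + 1) ^ 3 with hc3
  have hk1 : 2 ^ (k - 1) ≤ 2 ^ k := Nat.pow_le_pow_right (by omega) (by omega)
  obtain ⟨b', hb', hbOK, -, -⟩ := NegFFT.prodTreeH_spec hNodd hN1 (e := e) hvs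
  rw [hb] at hb'
  obtain rfl : b = b' := by simpa using hb'
  -- tree
  have h1 := runs_a1Tree h hNodd hN1 hn (by omega) T hI hCI u hw hsched hhist hbg hkn' hbf hvs hvN ha1v ha1p hl1 hx1 hx2 hx3 hx4 hx5 hx6 hfl1 hl4 hptk hptu
  let s1 : HSlots := { u with a1v := [], l1 := encVec vs, ptk := encodeNat (2 + e), gw := { u.gw with bf := encBlocks (NegFFT.prodTreeH N e vs) } }
  -- coefficients
  have h2 := runs_a1Coef h hN1 hn (by omega) T hI s1 hbOK (by simp [s1, hb]) hcN (by simp [s1, ha1c]) (by simp [s1, ha1p]) (by simp [s1]) (by simp [s1, hblc2])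
    (by simp [s1, hblf]) (by simp [s1, hx3]) (by simp [s1, hx4]) (by simp [s1, hx5]) (by simp [s1, hu1]) (by simp [s1, hl4])
  set g := a1Coefs N cc b (2 ^ e + 1) with hg0
  have hgl : g.length = 2 ^ e + 1 := by simp [hg0, a1Coefs]
  have hgN : ∀ x ∈ g, x < N := fun x hx => by
    simp only [hg0, a1Coefs, List.mem_map, List.mem_range] at hx; obtain ⟨j, -, rfl⟩ := hx; exact Nat.mod_lt _ hN0
  have hgne : g ≠ [] := by intro h0; rw [h0] at hgl; simp at hgl
  let s2 : HSlots := { s1 with ptk := [], gw := { s1.gw with bf := [] } }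
  -- Bluestein
  have hclean2 : s2.gw.Clean := by unfold GSlots.Clean at hw ⊢; simpa [s2, s1] using hw
  have h3 := runs_bluestein h hNodd hN1 hn hk hkn T hI hCI s2 hclean2 (by simp [s2, s1, hsched]) (by simp [s2, s1, hhist]) (by simp [s2, s1, hkn'])
    (by simp [s2]) (by simp [s2, s1, hbg]) hgne hgN hm (by rw [hgl]; omega) hαN (by simp [s2, s1, hbla]) (by simp [s2, s1, hblm]) (by simp [s2, s1, hblk])
    (by simp [s2, s1, hblpow]) (by simp [s2, s1, hble]) (by simp [s2, s1, hblc1]) (by simp [s2, s1, hblc2]) (by simp [s2, s1, hblout])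
    (by simp [s2, s1, hx2]) (by simp [s2, s1, hx3]) (by simp [s2, s1, hx4]) (by simp [s2, s1, hx5]) (by simp [s2, s1, hx6]) (by simp [s2, s1, hfl1])
    (by simp [s2, s1, hu1]) (by simp [s2, s1, hl4])
  have h23 : hSt h T { s1 with ptk := [], blf := encVec g, gw := { s1.gw with bf := [] } } = hSt h T { s2 with blf := encVec g } := by simp [s2]
  rw [h23] at h2
  set ws := NegFFT.bluesteinValues N α m k g with hws0
  have hwsl : ws.length = m := by simp [hws0, NegFFT.bluesteinValues]
  have hwsN : ∀ w ∈ ws, w < N := fun w hw' => by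
    simp only [hws0, NegFFT.bluesteinValues, List.mem_map, List.mem_range] at hw'; obtain ⟨j, -, rfl⟩ := hw'; exact Nat.mod_lt _ hN0
  let s3 : HSlots := { s2 with blf := [], blout := encVec ws }
  -- value scan
  have h4 := runs_a1Scan1 h hN1 hn hkn T hI s3 hwsl hwsN (by omega) (by simp [s3]) (by simp [s3, s2, s1, hblm]) (by simp [s3, s2, s1, hx1]) (by simp [s3, s2, s1, hx2])
    (by simp [s3, s2, s1, hx3]) (by simp [s3, s2, s1, hx4]) (by simp [s3, s2, s1, hx5]) (by simp [s3, s2, s1, hx6]) (by simp [s3, s2, s1, hu1])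
    (by simp [s3, s2, s1, hblc2]) (by simp [s3, s2, s1, hfl2]) (by simp [s3, s2, s1, ha1i]) (by simp [s3, s2, s1, ha1ai]) (by simp [s3, s2, s1, ha1g])
  rw [hgl] at h3
  -- clean-up, generic
  have hclean : ∀ (v : HSlots) (l1v x1v bmv f2v : List Bool), v.l1 = l1v → l1v.length ≤ 2 ^ e * (2 * n) → v.x1 = x1v → x1v.length ≤ n → v.blm = bmv →
      bmv.length ≤ n → v.fl2 = f2v → f2v.length ≤ n →
      Runs (a1Cleanup h) (base (hSt h T v)) (base (hSt h T { v with l1 := [], x1 := [], blm := [], fl2 := [] })) ((2 * (2 ^ e * (2 * n)) + 1) + 9 * c) := by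
    intro v l1v x1v bmv f2v e1 e1l e2 e2l e3 e3l e4 e4l
    have q1 : Runs (clear (Sum.inr (h .L1))) (base (hSt h T v)) (base (hSt h T { v with l1 := [] })) (2 * (2 ^ e * (2 * n)) + 1) := by
      refine (runs_clear (Sum.inr (h .L1)) (base (hSt h T v))).of_eq (by simp) ?_
      simp only [nst_inr, hSt_L1, e1]; omega
    have q2 : Runs ((NS.ofList [.clear (h .X1), .clear (h .BLM), .clear (h .FL2)] : NS β).com) (base (hSt h T { v with l1 := [] }))
        (base (hSt h T { v with l1 := [], x1 := [], blm := [], fl2 := [] })) (9 * c) := by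
      refine NS.runs_of_eq (N := n) _ _ ?_ (by simp) (by simp [hc3])
      simp only [NS.ofList, NS.ok, NOp.ok, NS.eval, NOp.eval, hSt_X1, hSt_BLM, hSt_FL2, update_hSt_X1, update_hSt_BLM, e2, e3, e4, and_true]
      exact ⟨e2l, e3l, e4l⟩
    exact q1.seq q2
  have hlV : (encVec vs).length ≤ 2 ^ e * (2 * n) := by have := length_encVec_le_of_lt hvN hn; rwa [hvs] at this
  have hl1e : (encodeNat 1).length ≤ n := by
    rw [show encodeNat 1 = [true] by simpa using encodeNat_two_pow 0]; simp only [List.length_cons, List.length_nil]; omega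
  have hlm' : (encodeNat m).length ≤ n :=
    length_le_of_le_two_pow_two_mul ((show m ≤ 2 ^ k by omega).trans (Nat.pow_le_pow_right (by omega) (by omega))) hkn
  have hl2e' : (encodeNat (2 ^ e)).length ≤ n := by rw [encodeNat_two_pow]; simp; omega
  have hgw : ∀ w : GSlots, w.bf = [] → ({ w with bf := [] } : GSlots) = w := by rintro ⟨⟩ h1; simp_all
  have hγf : ∀ i₀, Nat.gcd (ws[i₀]?.getD 0) N = Nat.gcd (ws.getD i₀ 0) N := fun i₀ => by rw [List.getD_eq_getElem?_getD]
  -- the cases of the outcome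
  rcases firstHit_spec (gcdHit N ws) m with ⟨hnone, -⟩ | ⟨i₀, hsome, hi₀m, -, -⟩
  · -- nothing found
    have h4' : Runs (a1Scan1 h) (base (hSt h T s3)) (base (hSt h T { s3 with x1 := encodeNat 1, blout := [] })) (a1Scan1Cost n k m) := by
      refine h4.of_eq ?_ le_rfl; simp only [HSlots.scan1Res, hnone]
    have h5 := runs_a1Scan2_nil h T { s3 with x1 := encodeNat 1, blout := [] } (by simp [s3, s2, s1, ha1ai])
    have h6 := hclean { s3 with x1 := encodeNat 1, blout := [] } (encVec vs) (encodeNat 1) (encodeNat m) [] (by simp [s3, s2, s1]) hlV (by simp) hl1e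
      (by simp [s3, s2, s1, hblm]) hlm' (by simp [s3, s2, s1, hfl2]) (by simp)
    refine (h1.seq (h2.seq (h3.seq (h4'.seq (h5.seq h6))))).of_eq ?_ ?_
    · simp only [alg1Out, ← hg0, ← hws0, hnone, HSlots.alg1Final, encOpt, flagOpt]
      rw [← hgw u.gw hbf]
      simp [s3, s2, s1, hptu, ha1g, hblfp, hblg, ha1ai, ha1i]
    · simp only [alg1Cost, a1Scan2Cost, ← hc3]; omega
  · by_cases hγ : Nat.gcd (ws.getD i₀ 0) N = N
    · -- the second scan runs
      let s4 : HSlots := { (s3.fnd1 N ws 0 i₀ N) with x1 := encodeNat 1, blout := [], blc2 := [] }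
      have h4' : Runs (a1Scan1 h) (base (hSt h T s3)) (base (hSt h T s4)) (a1Scan1Cost n k m) := by
        refine h4.of_eq ?_ le_rfl; simp only [HSlots.scan1Res, hsome, hγ, s4]
      have h5 := runs_a1Scan2_true h hN1 hn (by omega) hkn T hI s4 hvs hvN hαN hcN (show i₀ < 2 ^ k by omega) (by simp [s4, s3, s2, s1, HSlots.fnd1])
        (by simp [s4, s3, s2, s1, HSlots.fnd1, hbla]) (by simp [s4, s3, s2, s1, HSlots.fnd1, ha1c]) (by simp [s4, HSlots.fnd1]) (by simp [s4, HSlots.fnd1])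
        (by simp [s4, s3, s2, s1, HSlots.fnd1, ha1p]) (bm := encodeNat m) (by simp [s4, s3, s2, s1, HSlots.fnd1, hblm]) hlm' (x1v := encodeNat 1) (by simp [s4]) hl1e
        (by simp [s4, HSlots.fnd1]) (by simp [s4, s3, s2, s1, HSlots.fnd1, hblg]) (by simp [s4, s3, s2, s1, HSlots.fnd1, hblfp]) (by simp [s4, s3, s2, s1, HSlots.fnd1, ha1g])
        (by simp [s4, s3, s2, s1, HSlots.fnd1, hx2]) (by simp [s4, s3, s2, s1, HSlots.fnd1, hx3]) (by simp [s4, s3, s2, s1, HSlots.fnd1, hx4])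
        (by simp [s4, s3, s2, s1, HSlots.fnd1, hx5]) (by simp [s4, s3, s2, s1, HSlots.fnd1, hx6]) (by simp [s4, HSlots.fnd1])
        (by simp [s4]) (by simp [s4, s3, s2, s1, HSlots.fnd1, hfl1]) (by simp [s4, s3, s2, s1, HSlots.fnd1, hl4]) (by simp [s4])
      set rs := a1Resids N (α ^ i₀ % N * cc % N) vs with hrs0
      let s5base : HSlots := { s4 with l1 := [], a1i := [], a1ai := [], blfp := [true], blg := encodeNat i₀, fl2 := [], x1 := [], blm := encodeNat (2 ^ e) }
      rcases firstHit_spec (gcdHit N rs) (2 ^ e) with ⟨hnone2, -⟩ | ⟨h₀, hsome2, hh₀, -, -⟩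
      · have h5' : Runs (a1Scan2 h) (base (hSt h T s4)) (base (hSt h T { s5base with x1 := encodeNat 1, blout := [] })) (a1Scan2Cost n e) := by
          refine h5.of_eq ?_ le_rfl; simp only [HSlots.scan1Res, hnone2, s5base]
        have h6 := hclean { s5base with x1 := encodeNat 1, blout := [] } [] (encodeNat 1) (encodeNat (2 ^ e)) [] (by simp [s5base]) (by simp) (by simp) hl1e
          (by simp [s5base]) hl2e' (by simp [s5base]) (by simp)
        refine (h1.seq (h2.seq (h3.seq (h4'.seq (h5'.seq h6))))).of_eq ?_ ?_
        · simp only [alg1Out, ← hg0, ← hws0, hsome, hγ, if_true, ← hrs0, hnone2, HSlots.alg1Final, encOpt, flagOpt]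
          rw [← hgw u.gw hbf]
          simp [s5base, s4, s3, s2, s1, HSlots.fnd1, hptu, ha1g, hu1, hblc2]
        · simp only [alg1Cost, ← hc3]; omega
      · by_cases hγ2 : Nat.gcd (rs.getD h₀ 0) N = N
        · have h5' : Runs (a1Scan2 h) (base (hSt h T s4)) (base (hSt h T { (s5base.fnd1 N rs 0 h₀ N) with x1 := encodeNat 1, blout := [], blc2 := [] })) (a1Scan2Cost n e) := by
            refine h5.of_eq ?_ le_rfl; simp only [HSlots.scan1Res, hsome2, hγ2, s5base]
          have h6 := hclean { (s5base.fnd1 N rs 0 h₀ N) with x1 := encodeNat 1, blout := [], blc2 := [] } [] (encodeNat 1) (encodeNat (2 ^ e)) [true]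
            (by simp [s5base, HSlots.fnd1]) (by simp) (by simp) hl1e (by simp [s5base, HSlots.fnd1]) hl2e' (by simp [HSlots.fnd1]) (by simp only [List.length_cons, List.length_nil]; omega)
          refine (h1.seq (h2.seq (h3.seq (h4'.seq (h5'.seq h6))))).of_eq ?_ ?_
          · simp only [alg1Out, ← hg0, ← hws0, hsome, hγ, if_true, ← hrs0, hsome2, hγ2, HSlots.alg1Final, encOpt, flagOpt]
            rw [← hgw u.gw hbf]
            simp [s5base, s4, s3, s2, s1, HSlots.fnd1, hptu, ha1g, hu1, hblc2]
          · simp only [alg1Cost, ← hc3]; omega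
        · have h5' : Runs (a1Scan2 h) (base (hSt h T s4))
              (base (hSt h T { (s5base.fnd1 N rs 0 h₀ (Nat.gcd (rs.getD h₀ 0) N)) with x1 := encodeNat 1, blout := [], blc2 := [] })) (a1Scan2Cost n e) := by
            refine h5.of_eq ?_ le_rfl; simp only [HSlots.scan1Res, hsome2, s5base]
          have h6 := hclean { (s5base.fnd1 N rs 0 h₀ (Nat.gcd (rs.getD h₀ 0) N)) with x1 := encodeNat 1, blout := [], blc2 := [] } [] (encodeNat 1) (encodeNat (2 ^ e)) [true]
            (by simp [s5base, HSlots.fnd1]) (by simp) (by simp) hl1e (by simp [s5base, HSlots.fnd1]) hl2e' (by simp [HSlots.fnd1]) (by simp only [List.length_cons, List.length_nil]; omega)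
          have hγ2' : ¬ Nat.gcd (rs[h₀]?.getD 0) N = N := by rwa [List.getD_eq_getElem?_getD] at hγ2
          refine (h1.seq (h2.seq (h3.seq (h4'.seq (h5'.seq h6))))).of_eq ?_ ?_
          · simp only [alg1Out, ← hg0, ← hws0, hsome, hγ, if_true, ← hrs0, hsome2, hγ2, if_false, HSlots.alg1Final, encOpt, flagOpt]
            rw [← hgw u.gw hbf]
            simp [s5base, s4, s3, s2, s1, HSlots.fnd1, hptu, ha1g, hγ2', hu1, hblc2]
          · simp only [alg1Cost, ← hc3]; omega
    · -- a proper factor at the value scan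
      let s4 : HSlots := { (s3.fnd1 N ws 0 i₀ (Nat.gcd (ws.getD i₀ 0) N)) with x1 := encodeNat 1, blout := [], blc2 := [] }
      have h4' : Runs (a1Scan1 h) (base (hSt h T s3)) (base (hSt h T s4)) (a1Scan1Cost n k m) := by
        refine h4.of_eq ?_ le_rfl; simp only [HSlots.scan1Res, hsome, s4]
      have hγ' : ¬ Nat.gcd (ws[i₀]?.getD 0) N = N := by rwa [List.getD_eq_getElem?_getD] at hγ
      have h5 := runs_a1Scan2_nil h T s4 (by simp [s4, s3, s2, s1, HSlots.fnd1, hγ', ha1ai])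
      have h6 := hclean s4 (encVec vs) (encodeNat 1) (encodeNat m) [true] (by simp [s4, s3, s2, s1, HSlots.fnd1]) hlV (by simp [s4]) hl1e
        (by simp [s4, s3, s2, s1, HSlots.fnd1, hblm]) hlm' (by simp [s4, HSlots.fnd1]) (by simp only [List.length_cons, List.length_nil]; omega)
      refine (h1.seq (h2.seq (h3.seq (h4'.seq (h5.seq h6))))).of_eq ?_ ?_
      · simp only [alg1Out, ← hg0, ← hws0, hsome, hγ, if_false, HSlots.alg1Final, encOpt, flagOpt]
        rw [← hgw u.gw hbf]
        simp [s4, s3, s2, s1, HSlots.fnd1, hptu, hγ', hblfp, hblg, ha1ai, ha1i, hu1, hblc2]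
      · simp only [alg1Cost, a1Scan2Cost, ← hc3]; omega

/-! #### What the outcome of Algorithm 1 means

With `F = ∏ₕ (X − v_h)` the values scanned are `w_i = α^E · F(c α^i)` in `ℤ/N` (product tree,
coefficient scaling, Bluestein), so: a reported factor is a proper divisor of `N`; "nothing found"
means no `v_h` is congruent to any `c α^i` modulo any prime factor of `N` (for `α` a unit); an exact
hit `h` at `i` means `v_h ≡ c α^i (mod N)`; and a hit at `i` without an exact hit cannot happen. -/

section AlgOneMath

open _root_.Polynomial

/-- The tree's block has no coefficients above the degree `2^e`. [folklore] -/
theorem prodTreeH_getD_eq_zero {N e : ℕ} (hNodd : Odd N) (hN1 : 1 < N) {vs : List ℕ} (hvs : vs.length = 2 ^ e) {b : List ℕ}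
    (hb : NegFFT.prodTreeH N e vs = [b]) {j : ℕ} (hj : 2 ^ e < j) : b.getD j 0 = 0 := by
  obtain ⟨b', hb', hbOK, -, hpoly⟩ := NegFFT.prodTreeH_spec hNodd hN1 (e := e) hvs
  rw [hb] at hb'
  obtain rfl : b = b' := by simpa using hb'
  haveI : Fact (1 < N) := ⟨hN1⟩
  have hmonic : ∀ l : List ℕ, ((l.map fun v : ℕ => X - C (v : ZMod N)).prod).Monic ∧ ((l.map fun v : ℕ => X - C (v : ZMod N)).prod).natDegree = l.length := by
    intro l
    induction l with
    | nil => simp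
    | cons v l ih =>
      simp only [List.map_cons, List.prod_cons, List.length_cons]
      refine ⟨(monic_X_sub_C _).mul ih.1, ?_⟩
      rw [(monic_X_sub_C _).natDegree_mul ih.1, natDegree_X_sub_C, ih.2]; omega
  have hcoeff : (listPoly N b).coeff j = 0 := by
    rw [hpoly]; exact coeff_eq_zero_of_natDegree_lt (by rw [(hmonic vs).2, hvs]; exact hj)
  rw [coeff_listPoly] at hcoeff
  have hlt : b.getD j 0 < N := by
    by_cases hjl : j < b.length
    · rw [List.getD_eq_getElem _ _ hjl]; exact hbOK.2 _ (List.getElem_mem hjl)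
    · rw [List.getD_eq_default _ _ (by omega)]; omega
  exact Nat.eq_zero_of_dvd_of_lt ((ZMod.natCast_eq_zero_iff _ _).1 hcoeff) hlt

/-- The scaled coefficient list evaluates the tree polynomial at `c x`. [folklore] -/
theorem eval_listPoly_a1Coefs {N e cc : ℕ} (hNodd : Odd N) (hN1 : 1 < N) {vs : List ℕ} (hvs : vs.length = 2 ^ e) {b : List ℕ}
    (hb : NegFFT.prodTreeH N e vs = [b]) (x : ZMod N) :
    (listPoly N (a1Coefs N cc b (2 ^ e + 1))).eval x = ((vs.map fun v : ℕ => X - C (v : ZMod N)).prod).eval ((cc : ZMod N) * x) := by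
  obtain ⟨b', hb', hbOK, -, hpoly⟩ := NegFFT.prodTreeH_spec hNodd hN1 (e := e) hvs
  rw [hb] at hb'
  obtain rfl : b = b' := by simpa using hb'
  have hz : ∀ j, 2 ^ e < j → b.getD j 0 = 0 := fun j hj => prodTreeH_getD_eq_zero hNodd hN1 hvs hb hj
  rw [← hpoly, NegFFT.eval_listPoly, NegFFT.eval_listPoly]
  have hl : (a1Coefs N cc b (2 ^ e + 1)).length = 2 ^ e + 1 := by simp [a1Coefs]
  rw [hl]
  have h4 : 2 ^ e + 1 ≤ b.length := by rw [hbOK.1, pow_add]; have := Nat.one_le_two_pow (n := e); omega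
  rw [← Finset.sum_range_add_sum_Ico _ h4]
  have hzero : ∑ j ∈ Finset.Ico (2 ^ e + 1) b.length, ((b.getD j 0 : ℕ) : ZMod N) * ((cc : ZMod N) * x) ^ j = 0 :=
    Finset.sum_eq_zero fun j hj => by rw [hz j (by have := (Finset.mem_Ico.1 hj).1; omega)]; simp
  rw [hzero, add_zero]
  refine Finset.sum_congr rfl fun j hj => ?_
  have hjr : j < 2 ^ e + 1 := Finset.mem_range.1 hj
  have hget : (a1Coefs N cc b (2 ^ e + 1)).getD j 0 = cc ^ j % N * b.getD j 0 % N := by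
    rw [a1Coefs, List.getD_eq_getElem?_getD, List.getElem?_map, List.getElem?_range hjr]; rfl
  rw [hget]
  simp only [ZMod.natCast_mod, Nat.cast_mul, Nat.cast_pow]
  ring

/-- **The scanned values**: `w_i = α^E · ∏ₕ (c α^i − v_h)` in `ℤ/N`, `i < m`. [folklore] -/
theorem alg1_value_eq {N e cc α m k : ℕ} (hNodd : Odd N) (hN1 : 1 < N) (hk : 1 ≤ k) (hkm : 2 ^ e + m ≤ 2 ^ (k - 1)) {vs : List ℕ}
    (hvs : vs.length = 2 ^ e) {b : List ℕ} (hb : NegFFT.prodTreeH N e vs = [b]) {i : ℕ} (hi : i < m) :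
    (((NegFFT.bluesteinValues N α m k (a1Coefs N cc b (2 ^ e + 1))).getD i 0 : ℕ) : ZMod N) =
      (α : ZMod N) ^ ((2 ^ e + 1).choose 2 + m.choose 2) * (vs.map fun v : ℕ => (cc : ZMod N) * (α : ZMod N) ^ i - (v : ZMod N)).prod := by
  set g := a1Coefs N cc b (2 ^ e + 1) with hg0
  have hgl : g.length = 2 ^ e + 1 := by simp [hg0, a1Coefs]
  have hgne : g ≠ [] := by intro h0; rw [h0] at hgl; simp at hgl
  rw [NegFFT.bluesteinValues_spec hNodd hN1 hgne hk (by rw [hgl]; simpa using hkm) hi, hgl, Nat.add_sub_cancel,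
    hg0, eval_listPoly_a1Coefs hNodd hN1 hvs hb]
  congr 1
  rw [← Polynomial.coe_evalRingHom, map_list_prod, List.map_map]
  exact congrArg List.prod (List.map_congr_left fun v _ => by simp)

/-- A natural number below `N` has gcd `N` with `N` iff it is `0`. [folklore] -/
theorem gcd_eq_self_iff_of_lt {w N : ℕ} (hw : w < N) : Nat.gcd w N = N ↔ w = 0 := by
  constructor
  · intro h
    have : N ∣ w := h ▸ Nat.gcd_dvd_left w N
    exact Nat.eq_zero_of_dvd_of_lt this hw
  · rintro rfl; simp

/-- The residue of the second scan is `P − v` in `ℤ/N`. [folklore] -/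
theorem a1Resid_cast {N P v : ℕ} (hv : v < N) : ((((P + N - v) % N : ℕ)) : ZMod N) = (P : ZMod N) - (v : ZMod N) := by
  rw [ZMod.natCast_mod, Nat.cast_sub (by omega)]; push_cast; simp

/-- Units of `ℤ/N` do not vanish modulo a prime factor of `N`. [folklore] -/
theorem castHom_ne_zero_of_isUnit {N p : ℕ} (hp : p.Prime) (hpN : p ∣ N) {x : ZMod N} (hx : IsUnit x) :
    ZMod.castHom hpN (ZMod p) x ≠ 0 := by
  haveI : Fact p.Prime := ⟨hp⟩
  intro h0
  have := hx.map (ZMod.castHom hpN (ZMod p))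
  rw [h0] at this
  exact not_isUnit_zero this

/-- Factors of a unit product are units. [folklore] -/
theorem isUnit_of_mem_of_isUnit_prod {M : Type*} [CommMonoid M] : ∀ (l : List M), IsUnit l.prod → ∀ x ∈ l, IsUnit x
  | [], _, x, hx => by simp at hx
  | a :: l, h, x, hx => by
    rw [List.prod_cons, IsUnit.mul_iff] at h
    rcases List.mem_cons.1 hx with rfl | hx
    · exact h.1
    · exact isUnit_of_mem_of_isUnit_prod l h.2 x hx

/-- A product of units is a unit. [folklore] -/
theorem isUnit_prod_of_forall {M : Type*} [CommMonoid M] : ∀ (l : List M), (∀ x ∈ l, IsUnit x) → IsUnit l.prod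
  | [], _ => by simp
  | a :: l, h => by
    rw [List.prod_cons, IsUnit.mul_iff]
    exact ⟨h a (by simp), isUnit_prod_of_forall l fun x hx => h x (by simp [hx])⟩

/-- The entries of the residue list. [folklore] -/
theorem a1Resids_getD {N P : ℕ} {vs : List ℕ} {h₀ : ℕ} (hh : h₀ < vs.length) :
    (a1Resids N P vs).getD h₀ 0 = (P + N - vs.getD h₀ 0) % N := by
  rw [a1Resids, List.getD_eq_getElem _ _ (by simpa using hh), List.getElem_map, List.getD_eq_getElem _ _ hh]

/-- The shape of the outcome, by the cases of the two scans. [folklore] -/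
theorem alg1Out_shape (N α cc m k e : ℕ) (b vs : List ℕ) :
    (firstHit (gcdHit N (NegFFT.bluesteinValues N α m k (a1Coefs N cc b (2 ^ e + 1)))) m = none ∧ alg1Out N α cc m k e b vs = (none, none, none)) ∨
    (∃ i₀, firstHit (gcdHit N (NegFFT.bluesteinValues N α m k (a1Coefs N cc b (2 ^ e + 1)))) m = some i₀ ∧
      Nat.gcd ((NegFFT.bluesteinValues N α m k (a1Coefs N cc b (2 ^ e + 1))).getD i₀ 0) N ≠ N ∧
      alg1Out N α cc m k e b vs = (some (Nat.gcd ((NegFFT.bluesteinValues N α m k (a1Coefs N cc b (2 ^ e + 1))).getD i₀ 0) N), none, none)) ∨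
    (∃ i₀, firstHit (gcdHit N (NegFFT.bluesteinValues N α m k (a1Coefs N cc b (2 ^ e + 1)))) m = some i₀ ∧
      Nat.gcd ((NegFFT.bluesteinValues N α m k (a1Coefs N cc b (2 ^ e + 1))).getD i₀ 0) N = N ∧
      ((firstHit (gcdHit N (a1Resids N (α ^ i₀ % N * cc % N) vs)) (2 ^ e) = none ∧ alg1Out N α cc m k e b vs = (none, some i₀, none)) ∨
      (∃ h₀, firstHit (gcdHit N (a1Resids N (α ^ i₀ % N * cc % N) vs)) (2 ^ e) = some h₀ ∧
        Nat.gcd ((a1Resids N (α ^ i₀ % N * cc % N) vs).getD h₀ 0) N = N ∧ alg1Out N α cc m k e b vs = (none, some i₀, some h₀)) ∨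
      (∃ h₀, firstHit (gcdHit N (a1Resids N (α ^ i₀ % N * cc % N) vs)) (2 ^ e) = some h₀ ∧
        Nat.gcd ((a1Resids N (α ^ i₀ % N * cc % N) vs).getD h₀ 0) N ≠ N ∧
        alg1Out N α cc m k e b vs = (some (Nat.gcd ((a1Resids N (α ^ i₀ % N * cc % N) vs).getD h₀ 0) N), some i₀, none)))) := by
  cases hfi : firstHit (gcdHit N (NegFFT.bluesteinValues N α m k (a1Coefs N cc b (2 ^ e + 1)))) m with
  | none => exact Or.inl ⟨rfl, by simp only [alg1Out, hfi]⟩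
  | some i₀ =>
    by_cases hγ : Nat.gcd ((NegFFT.bluesteinValues N α m k (a1Coefs N cc b (2 ^ e + 1))).getD i₀ 0) N = N
    · right; right
      refine ⟨i₀, rfl, hγ, ?_⟩
      cases hfh : firstHit (gcdHit N (a1Resids N (α ^ i₀ % N * cc % N) vs)) (2 ^ e) with
      | none => exact Or.inl ⟨rfl, by simp only [alg1Out, hfi, hγ, if_true, hfh]⟩
      | some h₀ =>
        by_cases hγ2 : Nat.gcd ((a1Resids N (α ^ i₀ % N * cc % N) vs).getD h₀ 0) N = N
        · exact Or.inr (Or.inl ⟨h₀, rfl, hγ2, by simp only [alg1Out, hfi, hγ, if_true, hfh, hγ2]⟩)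
        · exact Or.inr (Or.inr ⟨h₀, rfl, hγ2, by simp only [alg1Out, hfi, hγ, if_true, hfh, hγ2, if_false]⟩)
    · right; left
      exact ⟨i₀, rfl, hγ, by simp only [alg1Out, hfi, hγ, if_false]⟩

/-- **Outcome "factor"**: a reported factor is a proper divisor of `N`. [folklore] -/
theorem alg1Out_factor {N α cc m k e : ℕ} (hN1 : 1 < N) {b vs : List ℕ} {g : ℕ}
    (hg : (alg1Out N α cc m k e b vs).1 = some g) : 1 < g ∧ g < N ∧ g ∣ N := by
  have hN0 : 0 < N := by omega
  have key : ∀ w : ℕ, Nat.gcd w N ≠ 1 → Nat.gcd w N ≠ N → 1 < Nat.gcd w N ∧ Nat.gcd w N < N ∧ Nat.gcd w N ∣ N := fun w h1 h2 => by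
    have hpos : 0 < Nat.gcd w N := Nat.gcd_pos_of_pos_right _ hN0
    have hle : Nat.gcd w N ≤ N := Nat.gcd_le_right _ hN0
    exact ⟨by omega, by omega, Nat.gcd_dvd_right _ _⟩
  rcases alg1Out_shape N α cc m k e b vs with ⟨-, ho⟩ | ⟨i₀, hfi, hγ, ho⟩ | ⟨i₀, hfi, hγ, ⟨-, ho⟩ | ⟨h₀, -, -, ho⟩ | ⟨h₀, hfh, hγ2, ho⟩⟩
  · rw [ho] at hg; simp at hg
  · rw [ho] at hg
    obtain rfl := Option.some.inj hg
    rcases firstHit_spec (gcdHit N (NegFFT.bluesteinValues N α m k (a1Coefs N cc b (2 ^ e + 1)))) m with ⟨hn', -⟩ | ⟨i₁, hs', -, hp', -⟩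
    · rw [hfi] at hn'; simp at hn'
    · rw [hfi] at hs'
      obtain rfl : i₀ = i₁ := by simpa using hs'
      exact key _ (by simpa [gcdHit] using hp') hγ
  · rw [ho] at hg; simp at hg
  · rw [ho] at hg; simp at hg
  · rw [ho] at hg
    obtain rfl := Option.some.inj hg
    rcases firstHit_spec (gcdHit N (a1Resids N (α ^ i₀ % N * cc % N) vs)) (2 ^ e) with ⟨hn', -⟩ | ⟨h₁, hs', -, hp', -⟩
    · rw [hfh] at hn'; simp at hn'
    · rw [hfh] at hs'
      obtain rfl : h₀ = h₁ := by simpa using hs'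
      exact key _ (by simpa [gcdHit] using hp') hγ2

/-- **Outcome "exact hit"**: `v_h ≡ c α^i (mod N)`, with the indices in range. [folklore] -/
theorem alg1Out_exact {N α cc m k e : ℕ} (hN1 : 1 < N) {b vs : List ℕ} (hvs : vs.length = 2 ^ e) (hvN : ∀ v ∈ vs, v < N) {i₀ h₀ : ℕ}
    (h2 : (alg1Out N α cc m k e b vs).2.1 = some i₀) (h3 : (alg1Out N α cc m k e b vs).2.2 = some h₀) :
    i₀ < m ∧ h₀ < 2 ^ e ∧ ((vs.getD h₀ 0 : ℕ) : ZMod N) = (cc : ZMod N) * (α : ZMod N) ^ i₀ := by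
  have hN0 : 0 < N := by omega
  rcases alg1Out_shape N α cc m k e b vs with ⟨-, ho⟩ | ⟨i₁, -, -, ho⟩ | ⟨i₁, hfi, -, ⟨-, ho⟩ | ⟨h₁, hfh, hγ2, ho⟩ | ⟨h₁, -, -, ho⟩⟩
  · rw [ho] at h2; simp at h2
  · rw [ho] at h2; simp at h2
  · rw [ho] at h3; simp at h3
  · rw [ho] at h2 h3
    obtain rfl : i₁ = i₀ := Option.some.inj h2
    obtain rfl : h₁ = h₀ := Option.some.inj h3
    rcases firstHit_spec (gcdHit N (NegFFT.bluesteinValues N α m k (a1Coefs N cc b (2 ^ e + 1)))) m with ⟨hn', -⟩ | ⟨i₂, hs', hi₂, -, -⟩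
    · rw [hfi] at hn'; simp at hn'
    rw [hfi] at hs'
    obtain rfl : i₁ = i₂ := by simpa using hs'
    rcases firstHit_spec (gcdHit N (a1Resids N (α ^ i₁ % N * cc % N) vs)) (2 ^ e) with ⟨hn', -⟩ | ⟨h₂, hs2, hh₂, -, -⟩
    · rw [hfh] at hn'; simp at hn'
    rw [hfh] at hs2
    obtain rfl : h₁ = h₂ := by simpa using hs2
    refine ⟨hi₂, hh₂, ?_⟩
    have hv : vs.getD h₁ 0 < N := by
      rw [List.getD_eq_getElem _ _ (by omega)]; exact hvN _ (List.getElem_mem _)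
    rw [a1Resids_getD (by omega)] at hγ2
    have hr0 := (gcd_eq_self_iff_of_lt (Nat.mod_lt _ hN0)).1 hγ2
    have hc := a1Resid_cast (P := α ^ i₁ % N * cc % N) hv
    rw [hr0, Nat.cast_zero] at hc
    have : ((vs.getD h₁ 0 : ℕ) : ZMod N) = ((α ^ i₁ % N * cc % N : ℕ) : ZMod N) := (sub_eq_zero.1 hc.symm).symm
    rw [this]; simp only [ZMod.natCast_mod, Nat.cast_mul, Nat.cast_pow]; ring
  · rw [ho] at h3; simp at h3

/-- **Outcome "nothing found"** (no factor, no hit): for `α` a unit, no value `v_h` is congruent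
to any `c α^i`, `i < m`, modulo any prime factor of `N`. [folklore] -/
theorem alg1Out_clear {N α cc m k e : ℕ} (hNodd : Odd N) (hN1 : 1 < N) (hk : 1 ≤ k) (hkm : 2 ^ e + m ≤ 2 ^ (k - 1))
    {vs : List ℕ} (hvs : vs.length = 2 ^ e) {b : List ℕ} (hb : NegFFT.prodTreeH N e vs = [b])
    (h1 : (alg1Out N α cc m k e b vs).1 = none) (h2 : (alg1Out N α cc m k e b vs).2.1 = none)
    {p : ℕ} (hp : p.Prime) (hpN : p ∣ N) {i : ℕ} (hi : i < m) {v : ℕ} (hv : v ∈ vs) :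
    ((cc : ZMod p)) * (α : ZMod p) ^ i ≠ (v : ZMod p) := by
  rcases alg1Out_shape N α cc m k e b vs with ⟨hnone, -⟩ | ⟨i₁, -, -, ho⟩ | ⟨i₁, -, -, ⟨-, ho⟩ | ⟨h₁, -, -, ho⟩ | ⟨h₁, -, -, ho⟩⟩
  · rcases firstHit_spec (gcdHit N (NegFFT.bluesteinValues N α m k (a1Coefs N cc b (2 ^ e + 1)))) m with ⟨-, hall⟩ | ⟨i₁, hs', -, -, -⟩
    · have hgi : Nat.gcd ((NegFFT.bluesteinValues N α m k (a1Coefs N cc b (2 ^ e + 1))).getD i 0) N = 1 := by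
        simpa [gcdHit] using hall i hi
      have hunit : IsUnit ((((NegFFT.bluesteinValues N α m k (a1Coefs N cc b (2 ^ e + 1))).getD i 0 : ℕ)) : ZMod N) :=
        (ZMod.isUnit_iff_coprime _ _).2 hgi
      rw [alg1_value_eq hNodd hN1 hk hkm hvs hb hi] at hunit
      have hfac : IsUnit ((cc : ZMod N) * (α : ZMod N) ^ i - (v : ZMod N)) :=
        isUnit_of_mem_of_isUnit_prod _ (IsUnit.mul_iff.1 hunit).2 _ (List.mem_map.2 ⟨v, hv, rfl⟩)
      intro heq
      apply castHom_ne_zero_of_isUnit hp hpN hfac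
      simp [map_sub, map_mul, map_pow, heq]
    · rw [hnone] at hs'; simp at hs'
  · rw [ho] at h1; simp at h1
  · rw [ho] at h2; simp at h2
  · rw [ho] at h2; simp at h2
  · rw [ho] at h1; simp at h1

/-- **A hit is always resolved**: for `α` a unit, the value scan cannot hit `N` at `i` without the
second scan finding a factor or an exact hit (one of the `c α^i − v_h` is a non-unit). [folklore] -/
theorem alg1Out_hit_resolved {N α cc m k e : ℕ} (hNodd : Odd N) (hN1 : 1 < N) (hk : 1 ≤ k) (hkm : 2 ^ e + m ≤ 2 ^ (k - 1)) (hα : Nat.Coprime α N)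
    {vs : List ℕ} (hvs : vs.length = 2 ^ e) (hvN : ∀ v ∈ vs, v < N) {b : List ℕ} (hb : NegFFT.prodTreeH N e vs = [b]) {i₀ : ℕ}
    (h1 : (alg1Out N α cc m k e b vs).1 = none) (h2 : (alg1Out N α cc m k e b vs).2.1 = some i₀) :
    (alg1Out N α cc m k e b vs).2.2 ≠ none := by
  have hN0 : 0 < N := by omega
  haveI : Fact (1 < N) := ⟨hN1⟩
  rcases alg1Out_shape N α cc m k e b vs with ⟨-, ho⟩ | ⟨i₁, -, -, ho⟩ | ⟨i₁, hfi, hγ, ⟨hfh, ho⟩ | ⟨h₁, -, -, ho⟩ | ⟨h₁, -, -, ho⟩⟩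
  · rw [ho] at h2; simp at h2
  · rw [ho] at h2; simp at h2
  · -- the impossible case: every residue is a unit, yet the product vanishes
    exfalso
    rcases firstHit_spec (gcdHit N (NegFFT.bluesteinValues N α m k (a1Coefs N cc b (2 ^ e + 1)))) m with ⟨hn', -⟩ | ⟨i₂, hs', hi₂, -, -⟩
    · rw [hfi] at hn'; simp at hn'
    rw [hfi] at hs'
    obtain rfl : i₁ = i₂ := by simpa using hs'
    rcases firstHit_spec (gcdHit N (a1Resids N (α ^ i₁ % N * cc % N) vs)) (2 ^ e) with ⟨-, hall⟩ | ⟨h₂, hs2, -, -, -⟩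
    · -- the value is zero in ℤ/N
      have hw : (NegFFT.bluesteinValues N α m k (a1Coefs N cc b (2 ^ e + 1))).getD i₁ 0 < N := by
        set ws := NegFFT.bluesteinValues N α m k (a1Coefs N cc b (2 ^ e + 1))
        by_cases hl : i₁ < ws.length
        · rw [List.getD_eq_getElem _ _ hl]
          have hmem : ws[i₁] ∈ ws := List.getElem_mem hl
          have hall' : ∀ w ∈ ws, w < N := fun w hw' => by
            simp only [ws, NegFFT.bluesteinValues, List.mem_map, List.mem_range] at hw'
            obtain ⟨j, -, rfl⟩ := hw'; exact Nat.mod_lt _ hN0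
          exact hall' _ hmem
        · rw [List.getD_eq_default _ _ (by omega)]; exact hN0
      have hzero : ((((NegFFT.bluesteinValues N α m k (a1Coefs N cc b (2 ^ e + 1))).getD i₁ 0 : ℕ)) : ZMod N) = 0 := by
        rw [(gcd_eq_self_iff_of_lt hw).1 hγ, Nat.cast_zero]
      rw [alg1_value_eq hNodd hN1 hk hkm hvs hb hi₂] at hzero
      -- every factor is a unit
      have hunits : ∀ x ∈ vs.map (fun v : ℕ => (cc : ZMod N) * (α : ZMod N) ^ i₁ - (v : ZMod N)), IsUnit x := by
        intro x hx
        obtain ⟨v, hv, rfl⟩ := List.mem_map.1 hx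
        obtain ⟨h₃, hh₃, hvh⟩ := List.getElem_of_mem hv
        have hh₃' : h₃ < 2 ^ e := by rw [← hvs]; exact hh₃
        have hg1 : Nat.gcd ((a1Resids N (α ^ i₁ % N * cc % N) vs).getD h₃ 0) N = 1 := by simpa [gcdHit] using hall h₃ hh₃'
        rw [a1Resids_getD hh₃] at hg1
        have hu := (ZMod.isUnit_iff_coprime _ _).2 hg1
        rw [List.getD_eq_getElem _ _ hh₃, hvh] at hu
        rw [a1Resid_cast (hvN v hv)] at hu
        have hP : (((α ^ i₁ % N * cc % N : ℕ)) : ZMod N) = (cc : ZMod N) * (α : ZMod N) ^ i₁ := by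
          simp only [ZMod.natCast_mod, Nat.cast_mul, Nat.cast_pow]; ring
        rwa [hP] at hu
      have hprod := isUnit_prod_of_forall _ hunits
      have hαu : IsUnit ((α : ZMod N) ^ ((2 ^ e + 1).choose 2 + m.choose 2)) := ((ZMod.isUnit_iff_coprime _ _).2 hα).pow _
      have := hαu.mul hprod
      rw [hzero] at this
      exact not_isUnit_zero this
    · rw [hfh] at hs2; simp at hs2
  · rw [ho]; simp
  · rw [ho] at h1; simp at h1

end AlgOneMath

end AlgOne

end Com

end Literature.Computability.Complexity
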